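import Mathlib.GroupTheory.PGroup
import Literature.NumberTheory.EllipticCurves.SupersingularTorsionDegreeBoundProofs
import Literature.NumberTheory.EllipticCurves.Kato2004.SemilocalDecompositionProofs
import Literature.NumberTheory.GaloisRepresentations.AbsGaloisRestrictCyclotomic
import Literature.NumberTheory.NumberFields.CyclotomicMaximalRealSubfieldDegree
import Literature.NumberTheory.EllipticCurves.Kobayashi2003.CyclotomicTowerSignedSelmer
import Literature.NumberTheory.EllipticCurves.Sprung2012.HondaSystemCyclotomicTowerPoints
import HarnessLib
/-!
# Honda systems at supersingular primes (Sprung 2012 Thm. 2.2 / Kobayashi 2003 §8), III: the signed local conditions along the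
# cyclotomic `ℤ_p`-tower — transversality, torsion descent, transitivity of the local traces, Kobayashi's signed generation
# (discharge / saturation / stabilisers / over `ℚ`), the `Δ`-descended layers and their Galois theory, local traces and the trace
# relations between the `ℤ_p`-layers and Kobayashi's tower (Kobayashi 2003 §8; Greenberg LNM 1716; Washington 1997)

**Kobayashi's signed local conditions along the cyclotomic `ℤ_p`-tower and the `Δ`-descent to the `ℤ_p`-layers** (S. Kobayashi,
Invent. Math. 152 (2003) §8: Prop. 8.7, Lemma 8.9, Prop. 8.11–8.12 [Kobayashi2003]; R. Greenberg, LNM 1716 [GreenbergLNM1716];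
L. Washington, *Cyclotomic Fields* [Washington1997]; J.-P. Serre, *Galois Cohomology* [SerreGaloisCohomology1997]; F. Sprung, J. Number
Theory 132 (2012) §7 [Sprung2012]): transversality of the signed conditions, torsion descent, transitivity of local traces, the signed
generation theorems, saturation of layers, stabilisers, the Galois theory of the descended layers, and the local trace relations.
RE-HOMED into `Literature/` by the Hodge foundations lane (`lit-hodgefound`, seat p20, generation 41): verbatim DECLARATION-LEVEL
ports, in dependency order, of the declarations of the modules `Summits/BirchSwinnertonDyer/{Rank1Residual/Additive, BirchSwinnertonDyer/Theorems}/CyclotomicTowerSignedLocalTransverse, CyclotomicTowerLocalTorsionDescent, CyclotomicTowerSignedLocalTraceTransitive,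
KobayashiSignedGenerationDischarge, KobayashiLayerSaturation, CyclotomicTowerLocalTorsionPadic, KobayashiSignedGenerationOfStab, CyclotomicTowerLocalStab,
KobayashiSignedGenerationRat, PrintX8VSInputHondaSystemLayerGalois, PrintX8VSInputHondaSystemLocalTraces, PrintX8VSInputHondaSystemLocalRelations.lean`
(BSD cells `b2b-bsdres` / `bsd-inputs`, where they certify `p`-adic analysis of formal groups and of the cyclotomic tower at a
supersingular prime — unconditional facts about elliptic curves over `ℚ` and `ℚ_p`, independent of the Birch–Swinnerton-Dyer conjecture),
namespaces `Summit.BirchSwinnertonDyer.Rank1Residual.Additive` and `Summit.BirchSwinnertonDyer.BirchSwinnertonDyer.Theorems` BOTH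
re-rooted as `Literature.NumberTheory.EllipticCurves.Sprung2012.Honda` (sub-namespaces `BallEval`, `PadicCyclotomicTower`, `HondaFss`,
`SprungHonda`, `SignedEC`, … kept).  The declarations of the cone that are already in `Literature/` (Kobayashi's signed local
conditions `localFixedPointsOfEmb`, `localPairTraceOfEmb`, `towerSubgroup`, … of
`NumberTheory/EllipticCurves/Kobayashi2003/CyclotomicTowerSignedSelmer.lean`) are IMPORTED, not duplicated.  Definitions are ported with
their bodies (real `def`s: evaluation maps, ball points, logarithms, towers, transported points — no `Prop`-valued placeholder, no
named fact: D-0026 net debt 0 for this file); every declaration carries the citation of the printed step it formalises or serves;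
imports Mathlib/Literature only.  The Summits originals stay in place (transitional duplication; twins = same short names under the two
Summits namespaces).  Nothing here bears on the Birch–Swinnerton-Dyer conjecture or any summit statement.
Builds on files I–II of the series; consumed by files IV–V (same directory).
-/

noncomputable section

open Literature.NumberTheory.EllipticCurves.Kobayashi2003

/-!
## Part 1 — port of `Summits/BirchSwinnertonDyer/Rank1Residual/Additive/CyclotomicTowerSignedLocalTransverse.lean` (1 declarations kept)

# The `η`-odd Kummer line is TRANSVERSE to Kobayashi's minus condition: a bottom-layer point `P`
# with `τP = −P` lies in `E⁻(K_{n,v}) + q·E(K_{n,v})` only if `P ∈ q·E(K_{0,v})`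
#  taken as hypotheses on the tree's OWN objects
# `towerSignedLocalPointsOfEmb` of `CyclotomicTowerSignedLocal.lean` (cc-typer-6 GEN 8))

(Port of the declarations listed in the Part header; the source module's docstring — cell bookkeeping of the BSD
printed-inputs programme — is abridged to its title here.)
-/

section Part1

open scoped _root_.Classical

universe u

namespace Literature.NumberTheory.EllipticCurves.Sprung2012.Honda

open Literature.NumberTheory.EllipticCurves Literature.NumberTheory.GaloisRepresentations
  Literature.NumberTheory.EllipticCurves.Kobayashi2003 ZpExtension

/-! ## §1 Normal stability of `E(L_w)` and Lemma 8.17 (saturation of the signed groups) -/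

section Stability

variable {K : Type u} [Field K] {E : Type u} [Field E] [Algebra K E]
  (ι : AlgebraicClosure K →ₐ[K] AlgebraicClosure E) (W : WeierstrassCurve K)

/-- For `H = Gal(K̄/L)` NORMAL in `Γ_K` the local subgroup `H_E` is normal in `Γ_E`, so `E(L_w)` is
stable under all of `Γ_E`: `τ • (g • P) = g • ((g⁻¹τg) • P) = g • P`. Serre, *Galois Cohomology*,
II.§1.1. [cite: SerreGaloisCohomology1997, II.§1.1] -/
theorem smul_mem_localFixedPointsOfEmb (H : Subgroup (Field.absoluteGaloisGroup K)) [hH : H.Normal]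
    (g : Field.absoluteGaloisGroup E) {P : localPoints W E}
    (hP : P ∈ localFixedPointsOfEmb ι W H) : g • P ∈ localFixedPointsOfEmb ι W H := by
  have hn : (localSubgroupOfEmb H ι).Normal := by
    unfold localSubgroupOfEmb
    exact hH.comap _
  rw [mem_localFixedPointsOfEmb_iff] at hP ⊢
  intro τ hτ
  have hc : g⁻¹ * τ * g ∈ localSubgroupOfEmb H ι := hn.conj_mem' τ hτ g
  calc τ • g • P = (g * (g⁻¹ * τ * g)) • P := by
        rw [← mul_smul]; congr 1; group
    _ = g • P := by rw [mul_smul, hP _ hc]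

variable (U : ℕ → Subgroup (Field.absoluteGaloisGroup K)) [hU : ∀ n, (U n).FiniteIndex]

end Stability

/-! ## §2 The bottom layer `K_{0,v}` inside the signed groups -/

section Bottom

variable {K : Type u} [Field K] {E : Type u} [Field E] [Algebra K E]
  (U : ℕ → Subgroup (Field.absoluteGaloisGroup K)) [hU : ∀ n, (U n).FiniteIndex]
  (ι : AlgebraicClosure K →ₐ[K] AlgebraicClosure E) (W : WeierstrassCurve K)

end Bottom

/-! ## §3 Transversality modulo Prop. 8.12 ii) -/

section Transverse

variable {K : Type u} [Field K] {E : Type u} [Field E] [Algebra K E]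
  (U : ℕ → Subgroup (Field.absoluteGaloisGroup K)) [hU : ∀ n, (U n).FiniteIndex]
  (ι : AlgebraicClosure K →ₐ[K] AlgebraicClosure E) (W : WeierstrassCurve K)

end Transverse

end Literature.NumberTheory.EllipticCurves.Sprung2012.Honda

end Part1

/-!
## Part 2 — port of `Summits/BirchSwinnertonDyer/Rank1Residual/Additive/CyclotomicTowerLocalTorsionDescent.lean` (7 declarations kept)

# Prop. 8.7 DESCENDS the `p`-tower: "no `p`-torsion in `E(K_{n,v})`" at EVERY layer `n` follows from
# the BOTTOM layer `E(K_{0,v})` alone — the `htors` hypothesis of files 1–4 of this series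
# (p312958 / p313494 / p314385 / p314968) reduced to ONE local field

(Port of the declarations listed in the Part header; the source module's docstring — cell bookkeeping of the BSD
printed-inputs programme — is abridged to its title here.)
-/

section Part2

open scoped _root_.Classical AddSubgroup

universe u

namespace Literature.NumberTheory.EllipticCurves.Sprung2012.Honda

open Literature.NumberTheory.EllipticCurves Literature.NumberTheory.GaloisRepresentations
  Literature.NumberTheory.EllipticCurves.Kobayashi2003 ZpExtension

/-! ## §1 A `p`-group fixed-point lemma for a normal pair of subgroups -/

section Abstract

variable {G : Type*} [Group G] {M : Type*} [AddCommGroup M] [DistribMulAction G M]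

/-- For `A` normal in `G`, the fixed points `Fix(A) ≤ M` are `G`-stable:
`a • (g • m) = g • ((g⁻¹ a g) • m) = g • m`. Greenberg, LNM 1716, §1 p. 62. [cite: Kobayashi2003, Prop. 8.7 (p. 16)] -/
theorem FixedPoints.smul_mem_addSubgroup_of_normal (A : Subgroup G) [hA : A.Normal] (g : G) {m : M}
    (hm : m ∈ FixedPoints.addSubgroup A M) : g • m ∈ FixedPoints.addSubgroup A M := by
  rw [FixedPoints.mem_addSubgroup] at hm ⊢
  rintro ⟨a, ha⟩
  rw [Subgroup.mk_smul]
  have hconj : g⁻¹ * a * g ∈ A := by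
    have h := hA.conj_mem a ha g⁻¹
    rwa [inv_inv] at h
  have h := hm ⟨g⁻¹ * a * g, hconj⟩
  rw [Subgroup.mk_smul] at h
  calc a • g • m = g • ((g⁻¹ * a * g) • m) := by rw [mul_smul, mul_smul, smul_inv_smul]
    _ = g • m := by rw [h]

/-- A subgroup without elements of order `q` has no elements of order `q^k` either:
`E(·)[q] = 0 ⟹ E(·)[q^∞] = 0`. [cite: Kobayashi2003, Prop. 8.7 (p. 16)] -/
theorem eq_zero_of_pow_smul_eq_zero_of_forall (S : AddSubgroup M) {q : ℕ}
    (h : ∀ Q ∈ S, q • Q = 0 → Q = 0) (k : ℕ) : ∀ Q ∈ S, q ^ k • Q = 0 → Q = 0 := by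
  induction k with
  | zero =>
    intro Q _ hQ
    rwa [pow_zero, one_smul] at hQ
  | succ k ih =>
    intro Q hQ hQk
    rw [pow_succ, mul_smul] at hQk
    exact h Q hQ (ih (q • Q) (S.nsmul_mem hQ q) hQk)

/-- **`p`-group fixed-point DESCENT for a normal pair.** Let `G` act on the abelian group `M` with
finite `p`-torsion `M[p]`, `A ⊴ G`, `B ≤ G` with `[B : A ∩ B] ∣ p^k`. If `Fix(B)` has no element of
order `p`, then `Fix(A)` has none: `V = Fix(A) ∩ M[p]` is finite, `B`-stable, acted on through a
`p`-group; a non-zero element would make `p ∣ #V`, and then the `p`-group fixed-point theorem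
(with the fixed point `0`) gives a non-zero `B`-fixed element of `V ⊆ M[p]`. Greenberg, LNM 1716,
proof of Prop. 4.8 (p. 109: "`M` is just a nonzero, finite, abelian `p`-group on which `Γ` acts.
Obviously, `M_Γ ≠ 0`", dually `M^Γ ≠ 0`). [cite: GreenbergLNM1716, §4 proof of Prop. 4.8 (p. 109); §1 p. 62] -/
theorem FixedPoints.eq_zero_of_prime_smul_eq_zero_of_index_dvd_pow {p : ℕ} [hp : Fact p.Prime]
    (A B : Subgroup G) [A.Normal] {k : ℕ} (hidx : (A.subgroupOf B).index ∣ p ^ k)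
    [hfin : Finite (M[(p : ℕ)])]
    (hB : ∀ m ∈ FixedPoints.addSubgroup B M, p • m = 0 → m = 0) :
    ∀ m ∈ FixedPoints.addSubgroup A M, p • m = 0 → m = 0 := by
  intro m hm hpm
  by_contra hm0
  -- `V = Fix(A) ∩ M[p]`, finite and `B`-stable
  set V : AddSubgroup M := FixedPoints.addSubgroup A M ⊓ M[(p : ℕ)] with hV
  have hmemV : ∀ {v : M}, v ∈ V ↔ v ∈ FixedPoints.addSubgroup A M ∧ p • v = 0 := by
    intro v
    rw [hV, AddSubgroup.mem_inf, AddSubgroup.torsionBy.nsmul_iff]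
  haveI hVfin : Finite V :=
    Finite.of_injective _ (AddSubgroup.inclusion_injective (inf_le_right : V ≤ _))
  have hstab : ∀ (b : B) (v : M), v ∈ V → (b : G) • v ∈ V := by
    intro b v hv
    rw [hmemV] at hv ⊢
    refine ⟨FixedPoints.smul_mem_addSubgroup_of_normal A (b : G) hv.1, ?_⟩
    rw [smul_comm, hv.2, smul_zero]
  -- the permutation action `ρ : B → Perm(V)`
  let ρ : B →* Equiv.Perm V :=
    { toFun := fun b ↦
        { toFun := fun v ↦ ⟨(b : G) • (v : M), hstab b _ v.2⟩
          invFun := fun v ↦ ⟨(b : G)⁻¹ • (v : M), hstab b⁻¹ _ v.2⟩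
          left_inv := fun v ↦ Subtype.ext (inv_smul_smul (b : G) (v : M))
          right_inv := fun v ↦ Subtype.ext (smul_inv_smul (b : G) (v : M)) }
      map_one' := Equiv.ext fun v ↦ Subtype.ext (one_smul G (v : M))
      map_mul' := fun b c ↦ Equiv.ext fun v ↦ Subtype.ext (mul_smul (b : G) (c : G) (v : M)) }
  have hρ : ∀ (b : B) (v : V), ((ρ b v : V) : M) = (b : G) • (v : M) := fun _ _ ↦ rfl
  -- `A ∩ B` acts trivially (definition of `Fix(A)`), so the range of `ρ` is a `p`-group
  have hker : A.subgroupOf B ≤ ρ.ker := by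
    intro b hb
    rw [Subgroup.mem_subgroupOf] at hb
    rw [MonoidHom.mem_ker]
    refine Equiv.ext fun v ↦ Subtype.ext ?_
    rw [hρ, Equiv.Perm.coe_one, id_eq]
    have h := (FixedPoints.mem_addSubgroup _ _ _).mp (hmemV.mp v.2).1 ⟨(b : G), hb⟩
    rwa [Subgroup.mk_smul] at h
  have hP : IsPGroup p ρ.range := by
    have h1 : ρ.ker.index ∣ p ^ k := (Subgroup.index_dvd_of_le hker).trans hidx
    rw [Subgroup.index_ker] at h1
    obtain ⟨j, -, hj⟩ := (Nat.dvd_prime_pow hp.out).mp h1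
    exact IsPGroup.of_card hj
  -- `m` is a non-zero element of `V` of order `p`, so `p ∣ #V`
  have hmV : m ∈ V := hmemV.mpr ⟨hm, hpm⟩
  have hdvd : p ∣ Nat.card V := by
    have hne : (⟨m, hmV⟩ : V) ≠ 0 := fun h ↦ hm0 (congrArg Subtype.val h)
    have hord : addOrderOf (⟨m, hmV⟩ : V) = p :=
      addOrderOf_eq_prime (Subtype.ext (by
        rw [AddSubmonoidClass.coe_nsmul, ZeroMemClass.coe_zero]; exact hpm)) hne
    rw [← hord]
    exact addOrderOf_dvd_natCard _
  -- `0` is a fixed point; the `p`-group fixed-point theorem gives another one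
  have h0 : (0 : V) ∈ MulAction.fixedPoints ρ.range V := by
    rintro ⟨π, hπ⟩
    obtain ⟨b, rfl⟩ := MonoidHom.mem_range.mp hπ
    rw [Subgroup.mk_smul, Equiv.Perm.smul_def]
    exact Subtype.ext (by rw [hρ, ZeroMemClass.coe_zero, smul_zero])
  obtain ⟨v, hv, hv0⟩ := hP.exists_fixed_point_of_prime_dvd_card_of_fixed_point V hdvd h0
  -- `v` is `B`-fixed and `p`-torsion, hence zero: contradiction
  have hvB : (v : M) ∈ FixedPoints.addSubgroup B M := by
    rw [FixedPoints.mem_addSubgroup]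
    intro b
    have h := hv ⟨ρ b, MonoidHom.mem_range.mpr ⟨b, rfl⟩⟩
    rw [Subgroup.mk_smul, Equiv.Perm.smul_def] at h
    have h' := congrArg (fun z : V ↦ (z : M)) h
    rw [Subgroup.smul_def]
    simpa only [hρ] using h'
  have hv00 : (v : M) = 0 := hB _ hvB (hmemV.mp v.2).2
  exact hv0 (Subtype.ext (by rw [hv00]; rfl)).symm

end Abstract

/-! ## §2 Local points: `E(L₁,w)[p] = 0 ⟹ E(L₂,w)[p] = 0` for a normal pair with `p`-power index -/

section Local

variable {K : Type u} [Field K] {E : Type u} [Field E] [Algebra K E]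
  (ι : AlgebraicClosure K →ₐ[K] AlgebraicClosure E) (W : WeierstrassCurve K) {p : ℕ} [hp : Fact p.Prime]

omit hp in
/-- Normality passes to the local subgroup: `H ⊴ Γ_K ⟹ H_E = (Γ_E → Γ_K)⁻¹(H) ⊴ Γ_E`
(`Subgroup.Normal.comap`). Serre, *Galois Cohomology*, II.§1.1. [cite: SerreGaloisCohomology1997, II.§1.1] -/
theorem normal_localSubgroupOfEmb (H : Subgroup (Field.absoluteGaloisGroup K)) [hH : H.Normal] :
    (localSubgroupOfEmb H ι).Normal :=
  hH.comap _

omit hp in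
/-- `E(K̄_E)[n]` is finite for `n ≠ 0` and `W` elliptic (Silverman *AEC* Cor. III.6.4, the tree's
`WeierstrassCurve.finite_torsionBy_baseChange` over `K̄_E`). [cite: SilvermanAEC2009, Cor. III.6.4] -/
theorem finite_torsionBy_localPoints [W.IsElliptic] {n : ℤ} (hn : n ≠ 0) :
    Finite ((localPoints W E)[n]) :=
  WeierstrassCurve.finite_torsionBy_baseChange W (AlgebraicClosure E) hn

/-- **Local `p`-torsion DESCENT.** For `H₁, H₂ ≤ Γ_K` with `H₂` normal and local pair index
`[(H₁)_E : (H₂)_E ∩ (H₁)_E]` dividing `p^k` (for `H_i = Gal(K̄/L_i)`, `L₁ ⊆ L₂`: `[L₂,w : L₁,w] ∣ p^k`),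
and `W` elliptic: if `E(L₁,w)` has no point of order `p`, then `E(L₂,w)` has none (§1 applied to
`Γ_E` acting on `E(K̄_E)`, whose `p`-torsion is finite). This is the group-theoretic half of
Kobayashi's Prop. 8.7 (`[k_n : k_0] = pⁿ`). [cite: Kobayashi2003, Prop. 8.7 (p. 16)]
[cite: GreenbergLNM1716, §4 proof of Prop. 4.8 (p. 109)] -/
theorem eq_zero_of_prime_smul_eq_zero_localFixedPointsOfEmb_of_index_dvd_pow [W.IsElliptic]
    (H₁ H₂ : Subgroup (Field.absoluteGaloisGroup K)) [H₂.Normal] {k : ℕ}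
    (hidx : ((localSubgroupOfEmb H₂ ι).subgroupOf (localSubgroupOfEmb H₁ ι)).index ∣ p ^ k)
    (h₁ : ∀ Q ∈ localFixedPointsOfEmb ι W H₁, p • Q = 0 → Q = 0) :
    ∀ Q ∈ localFixedPointsOfEmb ι W H₂, p • Q = 0 → Q = 0 := by
  haveI := normal_localSubgroupOfEmb ι H₂
  haveI : Finite ((localPoints W E)[(p : ℕ)]) :=
    finite_torsionBy_localPoints W (by exact_mod_cast hp.out.ne_zero)
  exact FixedPoints.eq_zero_of_prime_smul_eq_zero_of_index_dvd_pow
    (localSubgroupOfEmb H₂ ι) (localSubgroupOfEmb H₁ ι) hidx h₁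

end Local

/-! ## §3 A generic tower `U`: Prop. 8.7 at layer `n` from layer `0`; files 2/3 re-exported with the
bottom-layer hypothesis -/

section GenericTower

variable {K : Type u} [Field K] {E : Type u} [Field E] [Algebra K E]
  (ι : AlgebraicClosure K →ₐ[K] AlgebraicClosure E) (W : WeierstrassCurve K) [W.IsElliptic]
  {p : ℕ} [hp : Fact p.Prime]
  (U : ℕ → Subgroup (Field.absoluteGaloisGroup K)) [hU : ∀ n, (U n).FiniteIndex]

omit hU in
/-- **Prop. 8.7 descends the tower**: for `U n` normal with local layer indices
`[K_{n,v} : K_{m,v}]` dividing powers of `p` (`hidx`, files 2/3), `E(K_{0,v})[p] = 0` implies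
`E(K_{n,v})[p] = 0`. [cite: Kobayashi2003, Prop. 8.7 (p. 16)] -/
theorem eq_zero_of_prime_smul_eq_zero_localFixedPointsOfEmb_tower [hN : ∀ n, (U n).Normal] (n : ℕ)
    (hidx : ∀ m ≤ n, ∃ k : ℕ,
      ((localSubgroupOfEmb (U n) ι).subgroupOf (localSubgroupOfEmb (U m) ι)).index ∣ p ^ k)
    (h₀ : ∀ Q ∈ localFixedPointsOfEmb ι W (U 0), p • Q = 0 → Q = 0) :
    ∀ Q ∈ localFixedPointsOfEmb ι W (U n), p • Q = 0 → Q = 0 := by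
  obtain ⟨k, hk⟩ := hidx 0 (Nat.zero_le n)
  exact eq_zero_of_prime_smul_eq_zero_localFixedPointsOfEmb_of_index_dvd_pow ι W (U 0) (U n) hk h₀

end GenericTower

/-! ## §4 cc-typer-6's tower `towerSubgroup κ K₀`: Prop. 8.7 over the whole tower from `E(K_{0,v})` -/

section Tower

variable {K : Type u} [Field K] {p : ℕ} [hp : Fact p.Prime] (κ : ZpExtension K p)
  (K₀ : Type u) [Field K₀] [Algebra K K₀]
  {E : Type u} [Field E] [Algebra K E] (ι : AlgebraicClosure K →ₐ[K] AlgebraicClosure E)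
  (W : WeierstrassCurve K)

variable [(galRange (K := K) K₀).Normal] [W.IsElliptic]

variable [NumberField K] [NumberField K₀]

end Tower

end Literature.NumberTheory.EllipticCurves.Sprung2012.Honda

end Part2

/-!
## Part 3 — port of `Summits/BirchSwinnertonDyer/Rank1Residual/Additive/CyclotomicTowerSignedLocalTraceTransitive.lean` (3 declarations kept)

# The generic trace of cc-typer-6's tower is TRANSITIVE and Galois-EQUIVARIANT; `E^ε(K_{n,v})` is
# monotone in the layer and `Γ_E`-stable; the trivial bound
# `[K_{n+1,v} : K_{n,v}]·E(K_{n+1,v}) ⊆ E^{(−1)^{n+1}}(K_{n+1,v}) + E(K_{n,v})` — cell `b2b-bsdres`,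
# CLASS-CLOSURE lane, class O10 — x1b GEN 33, class lead; file 14 of the local series (the algebra
# under Kobayashi's Prop. 8.12 ii) generation half `E(K_{n,v}) = E⁺(K_{n,v}) + E⁻(K_{n,v})`, part 1)

(Port of the declarations listed in the Part header; the source module's docstring — cell bookkeeping of the BSD
printed-inputs programme — is abridged to its title here.)
-/

section Part3

open scoped _root_.Classical

universe u

namespace Literature.NumberTheory.EllipticCurves.Sprung2012.Honda

open Literature.NumberTheory.EllipticCurves Literature.NumberTheory.GaloisRepresentations
  Literature.NumberTheory.EllipticCurves.Kobayashi2003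

/-! ## §1 Trace transitivity and Galois equivariance of the generic trace -/

section Trans

variable {K : Type u} [Field K] {E : Type u} [Field E] [Algebra K E]
  (ι : AlgebraicClosure K →ₐ[K] AlgebraicClosure E) (W : WeierstrassCurve K)

/-- **Re-indexing the trace.** For `P ∈ E(L₂,w)` and ANY family `g : X → (H₁)_E` whose classes
`g x · ((H₂)_E ∩ (H₁)_E)` enumerate the quotient bijectively, `Tr_{L₂/L₁} P = ∑ₓ g x • P`
(the summand `q.out • P` only depends on the coset `q`, `out_smul_eq_of_mem_localFixedPointsOfEmb`).
[cite: Kobayashi2003, §2 p. 4 (the trace maps)] -/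
theorem localPairTraceOfEmb_eq_sum_of_bijective (H₁ H₂ : Subgroup (Field.absoluteGaloisGroup K))
    [H₂.FiniteIndex] {P : localPoints W E} (hP : P ∈ localFixedPointsOfEmb ι W H₂)
    {X : Type*} [Fintype X] (g : X → localSubgroupOfEmb H₁ ι)
    (hg : Function.Bijective fun x =>
      (QuotientGroup.mk (g x) : localSubgroupOfEmb H₁ ι ⧸
        (localSubgroupOfEmb H₂ ι).subgroupOf (localSubgroupOfEmb H₁ ι))) :
    localPairTraceOfEmb ι W H₁ H₂ P = ∑ x, ((g x : localSubgroupOfEmb H₁ ι) :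
      Field.absoluteGaloisGroup E) • P := by
  haveI : Fintype (localSubgroupOfEmb H₁ ι ⧸
      (localSubgroupOfEmb H₂ ι).subgroupOf (localSubgroupOfEmb H₁ ι)) := Fintype.ofFinite _
  rw [localPairTraceOfEmb_apply]
  rw [← hg.sum_comp (fun q : localSubgroupOfEmb H₁ ι ⧸
      (localSubgroupOfEmb H₂ ι).subgroupOf (localSubgroupOfEmb H₁ ι) =>
        ((q.out : localSubgroupOfEmb H₁ ι) : Field.absoluteGaloisGroup E) • P)]
  exact Finset.sum_congr rfl fun x _ => out_smul_eq_of_mem_localFixedPointsOfEmb ι W hP (g x)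

/-- **Transitivity of the trace**: for `H₃ ≤ H₂ ≤ H₁` (fields `L₁ ⊆ L₂ ⊆ L₃`), `H₂, H₃` of finite
index, and `P ∈ E(L₃,w)`: `Tr_{L₃/L₁} P = Tr_{L₂/L₁} (Tr_{L₃/L₂} P)` — the cosets of `(H₃)_E` in
`(H₁)_E` are the products `q̃ r̃` of coset representatives of `(H₂)_E` in `(H₁)_E` and of `(H₃)_E` in
`(H₂)_E` (Mathlib `Subgroup.quotientEquivProdOfLE`). For Kobayashi's tower:
`Tr_{n/m} = Tr_{k/m} ∘ Tr_{n/k}` (`m ≤ k ≤ n`). [cite: Kobayashi2003, §2 p. 4 (the trace maps Tr_{n/m+1})]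
[cite: SerreGaloisCohomology1997, I.§2.4] -/
theorem localPairTraceOfEmb_trans {H₁ H₂ H₃ : Subgroup (Field.absoluteGaloisGroup K)}
    [H₂.FiniteIndex] [H₃.FiniteIndex] (h₁₂ : H₂ ≤ H₁) (h₂₃ : H₃ ≤ H₂) {P : localPoints W E}
    (hP : P ∈ localFixedPointsOfEmb ι W H₃) :
    localPairTraceOfEmb ι W H₁ H₃ P =
      localPairTraceOfEmb ι W H₁ H₂ (localPairTraceOfEmb ι W H₂ H₃ P) := by
  -- notation: `A = (H₁)_E ⊇ B = (H₂)_E ⊇ C = (H₃)_E`; `t = B ∩ A ≤ A`, `s = C ∩ A ≤ A`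
  set A := localSubgroupOfEmb H₁ ι with hA
  set B := localSubgroupOfEmb H₂ ι with hB
  set C := localSubgroupOfEmb H₃ ι with hC
  have hBA : B ≤ A := Subgroup.comap_mono h₁₂
  have hCB : C ≤ B := Subgroup.comap_mono h₂₃
  have hst : C.subgroupOf A ≤ B.subgroupOf A := fun x hx => hCB hx
  haveI : Fintype (A ⧸ C.subgroupOf A) := Fintype.ofFinite _
  haveI : Fintype (A ⧸ B.subgroupOf A) := Fintype.ofFinite _
  haveI : Fintype (B ⧸ C.subgroupOf B) := Fintype.ofFinite _
  haveI : Fintype (B.subgroupOf A ⧸ (C.subgroupOf A).subgroupOf (B.subgroupOf A)) :=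
    Fintype.ofFinite _
  set e := Subgroup.quotientEquivProdOfLE hst with he
  -- (1) the inner sum over `t ⧸ s.subgroupOf t` is `Tr_{L₃/L₂} P`
  have hinner : localPairTraceOfEmb ι W H₂ H₃ P =
      ∑ r : B.subgroupOf A ⧸ (C.subgroupOf A).subgroupOf (B.subgroupOf A),
        (((r.out : B.subgroupOf A) : A) : Field.absoluteGaloisGroup E) • P := by
    let g : (B.subgroupOf A ⧸ (C.subgroupOf A).subgroupOf (B.subgroupOf A)) → B :=
      fun r => ⟨((r.out : B.subgroupOf A) : A), (r.out : B.subgroupOf A).2⟩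
    have hg : Function.Bijective fun r => (QuotientGroup.mk (g r) : B ⧸ C.subgroupOf B) := by
      constructor
      · intro r r' h
        rw [QuotientGroup.eq] at h
        rw [← QuotientGroup.out_eq' r, ← QuotientGroup.out_eq' r', QuotientGroup.eq]
        simpa [Subgroup.mem_subgroupOf, g] using h
      · intro q
        induction q using QuotientGroup.induction_on with
        | H b =>
          refine ⟨QuotientGroup.mk ⟨⟨(b : Field.absoluteGaloisGroup E), hBA b.2⟩, b.2⟩, ?_⟩
          rw [QuotientGroup.eq]
          obtain ⟨c, hc⟩ := QuotientGroup.mk_out_eq_mul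
            ((C.subgroupOf A).subgroupOf (B.subgroupOf A))
            (⟨⟨(b : Field.absoluteGaloisGroup E), hBA b.2⟩, b.2⟩ : B.subgroupOf A)
          have hc' : (((c : B.subgroupOf A) : A) : Field.absoluteGaloisGroup E) ∈ C := by
            have h2 := c.2
            rw [Subgroup.mem_subgroupOf, Subgroup.mem_subgroupOf] at h2
            exact h2
          simp only [Subgroup.mem_subgroupOf, g, hc, Subgroup.coe_mul, Subgroup.coe_inv]
          change ((b : Field.absoluteGaloisGroup E) *
            (((c : B.subgroupOf A) : A) : Field.absoluteGaloisGroup E))⁻¹ *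
              (b : Field.absoluteGaloisGroup E) ∈ C
          rw [mul_inv_rev, mul_assoc, inv_mul_cancel, mul_one]
          exact C.inv_mem hc'
    rw [localPairTraceOfEmb_eq_sum_of_bijective ι W H₂ H₃ hP g hg]
  -- (2) split the sum over `A ⧸ s` along `e`
  have hsplit : localPairTraceOfEmb ι W H₁ H₃ P =
      ∑ q : A ⧸ B.subgroupOf A, ((q.out : A) : Field.absoluteGaloisGroup E) •
        ∑ r : B.subgroupOf A ⧸ (C.subgroupOf A).subgroupOf (B.subgroupOf A),
          (((r.out : B.subgroupOf A) : A) : Field.absoluteGaloisGroup E) • P := by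
    rw [localPairTraceOfEmb_apply]
    rw [← e.symm.sum_comp (fun x : A ⧸ C.subgroupOf A =>
        ((x.out : A) : Field.absoluteGaloisGroup E) • P), Fintype.sum_prod_type]
    refine Finset.sum_congr rfl fun q _ => ?_
    rw [Finset.smul_sum]
    refine Finset.sum_congr rfl fun r _ => ?_
    induction r using QuotientGroup.induction_on with
    | H b =>
      have hx : e.symm (q, (QuotientGroup.mk b)) =
          QuotientGroup.mk (s := C.subgroupOf A) (q.out * (b : A)) := by
        rw [he, Subgroup.quotientEquivProdOfLE_symm_apply]
        rfl
      show (((e.symm (q, (QuotientGroup.mk b))).out : A) : Field.absoluteGaloisGroup E) • P =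
        ((q.out : A) : Field.absoluteGaloisGroup E) •
          ((((QuotientGroup.mk (s := (C.subgroupOf A).subgroupOf (B.subgroupOf A)) b).out :
            B.subgroupOf A) : A) : Field.absoluteGaloisGroup E) • P
      rw [hx, out_smul_eq_of_mem_localFixedPointsOfEmb ι W hP (q.out * (b : A)), Subgroup.coe_mul,
        mul_smul]
      congr 1
      obtain ⟨c, hc⟩ := QuotientGroup.mk_out_eq_mul
        ((C.subgroupOf A).subgroupOf (B.subgroupOf A)) b
      have hcC : (((c : B.subgroupOf A) : A) : Field.absoluteGaloisGroup E) ∈ C := by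
        have h2 := c.2
        rw [Subgroup.mem_subgroupOf, Subgroup.mem_subgroupOf] at h2
        exact h2
      rw [hc]
      show _ = ((((b : B.subgroupOf A) : A) : Field.absoluteGaloisGroup E) *
        (((c : B.subgroupOf A) : A) : Field.absoluteGaloisGroup E)) • P
      rw [mul_smul, (mem_localFixedPointsOfEmb_iff ι W H₃ P).mp hP _ hcC]
  rw [hsplit, ← hinner, localPairTraceOfEmb_apply ι W H₁ H₂]

/-- **Galois equivariance of the trace** for NORMAL `H₁, H₂`: `g • Tr_{L₂/L₁} P = Tr_{L₂/L₁} (g • P)`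
for every `g ∈ Γ_E` and `P ∈ E(L₂,w)` — conjugation by `g` permutes the cosets of `(H₂)_E` in
`(H₁)_E`. [cite: Kobayashi2003, §2 p. 4] [cite: SerreGaloisCohomology1997, II.§1.1] -/
theorem smul_localPairTraceOfEmb_of_normal (H₁ H₂ : Subgroup (Field.absoluteGaloisGroup K))
    [H₁.Normal] [H₂.Normal] [H₂.FiniteIndex] (g : Field.absoluteGaloisGroup E)
    {P : localPoints W E} (hP : P ∈ localFixedPointsOfEmb ι W H₂) :
    g • localPairTraceOfEmb ι W H₁ H₂ P = localPairTraceOfEmb ι W H₁ H₂ (g • P) := by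
  set A := localSubgroupOfEmb H₁ ι with hA
  set B := localSubgroupOfEmb H₂ ι with hB
  have hAn : A.Normal := normal_localSubgroupOfEmb ι H₁
  have hBn : B.Normal := normal_localSubgroupOfEmb ι H₂
  haveI : Fintype (A ⧸ B.subgroupOf A) := Fintype.ofFinite _
  have hgP : g • P ∈ localFixedPointsOfEmb ι W H₂ := smul_mem_localFixedPointsOfEmb ι W H₂ g hP
  -- conjugated representatives `g q̃ g⁻¹`
  let c : (A ⧸ B.subgroupOf A) → A := fun q =>
    ⟨g * (q.out : Field.absoluteGaloisGroup E) * g⁻¹, hAn.conj_mem _ (q.out).2 g⟩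
  have hc : Function.Bijective fun q => (QuotientGroup.mk (c q) : A ⧸ B.subgroupOf A) := by
    rw [← Finite.injective_iff_bijective]
    intro q q' h
    rw [QuotientGroup.eq] at h
    rw [← QuotientGroup.out_eq' q, ← QuotientGroup.out_eq' q', QuotientGroup.eq,
      Subgroup.mem_subgroupOf]
    simp only [Subgroup.mem_subgroupOf, c, Subgroup.coe_mul, Subgroup.coe_inv, mul_inv_rev,
      inv_inv] at h
    have h' : g * (((q.out : A) : Field.absoluteGaloisGroup E)⁻¹ *
        ((q'.out : A) : Field.absoluteGaloisGroup E)) * g⁻¹ ∈ B := by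
      have : g * (q.out : Field.absoluteGaloisGroup E)⁻¹ * g⁻¹ *
          (g * (q'.out : Field.absoluteGaloisGroup E) * g⁻¹) =
          g * (((q.out : A) : Field.absoluteGaloisGroup E)⁻¹ *
            ((q'.out : A) : Field.absoluteGaloisGroup E)) * g⁻¹ := by group
      rw [← this]; exact h
    have := hBn.conj_mem _ h' g⁻¹
    simpa [mul_assoc] using this
  rw [localPairTraceOfEmb_eq_sum_of_bijective ι W H₁ H₂ hgP c hc, localPairTraceOfEmb_apply,
    Finset.smul_sum]
  refine Finset.sum_congr rfl fun q _ => ?_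
  simp only [c, mul_smul, inv_smul_smul]

end Trans

/-! ## §2 Antitone normal towers: monotonicity, Galois stability of `E^ε`, the trivial bound -/

section Tower

variable {K : Type u} [Field K] {E : Type u} [Field E] [Algebra K E]
  (U : ℕ → Subgroup (Field.absoluteGaloisGroup K)) [hU : ∀ n, (U n).FiniteIndex]
  (ι : AlgebraicClosure K →ₐ[K] AlgebraicClosure E) (W : WeierstrassCurve K)

end Tower

end Literature.NumberTheory.EllipticCurves.Sprung2012.Honda

end Part3

/-!
## Part 4 — port of `Summits/BirchSwinnertonDyer/Rank1Residual/Additive/KobayashiSignedGenerationDischarge.lean` (10 declarations kept)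

# `hsum` DISCHARGED from Honda theory: for a tower `U` whose local subgroups are the stabilisers of
# `ζ_{p^{n+1}}` and a curve with a good supersingular `a_p = 0` model at `p` odd, every layer satisfies
# `E(K_{n,v}) = E⁺(K_{n,v}) + E⁻(K_{n,v})` (Kobayashi Prop. 8.12 ii), generation half) — given no
# `p`-power torsion in the `E(K_{n,v})` (Prop. 8.7, gen 32) and prime-to-`p` saturation of `E₁`
#

(Port of the declarations listed in the Part header; the source module's docstring — cell bookkeeping of the BSD
printed-inputs programme — is abridged to its title here.)
-/

section Part4

open scoped _root_.Classical
open _root_.Finset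

universe u

namespace Literature.NumberTheory.EllipticCurves.Sprung2012.Honda

open Literature.NumberTheory.EllipticCurves Literature.NumberTheory.GaloisRepresentations
  Literature.NumberTheory.EllipticCurves.FormalGroupChart _root_.WeierstrassCurve PadicCyclotomicTower BallEval _root_.Field

/-! ## §1 Point groups along an equality of Weierstrass equations -/

/-- **Transport of points along an equality `V₁ = V₂` of Weierstrass equations** (an additive
equivalence; the identity on coordinates). [cite: Kobayashi2003, §2 p. 4] -/
def ptCast {F : Type*} [Field F] {V₁ V₂ : WeierstrassCurve F} (h : V₁ = V₂) :
    V₁.toAffine.Point ≃+ V₂.toAffine.Point :=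
  h ▸ AddEquiv.refl V₁.toAffine.Point

/-- `ptCast` on an affine point. [cite: Kobayashi2003, §2 p. 4] -/
theorem ptCast_some {F : Type*} [Field F] {V₁ V₂ : WeierstrassCurve F} (h : V₁ = V₂) {x y : F}
    (hxy : V₁.toAffine.Nonsingular x y) :
    ptCast h (.some x y hxy) = .some x y (h ▸ hxy) := by
  subst h; rfl

/-- `ptCast.symm` on an affine point. [cite: Kobayashi2003, §2 p. 4] -/
theorem ptCast_symm_some {F : Type*} [Field F] {V₁ V₂ : WeierstrassCurve F} (h : V₁ = V₂) {x y : F}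
    (hxy : V₂.toAffine.Nonsingular x y) :
    (ptCast h).symm (.some x y hxy) = .some x y (h.symm ▸ hxy) := by
  subst h; rfl

section Main

variable {p : ℕ} [hp : Fact p.Prime] {K : Type} [Field K] [Algebra K ℚ_[p]]
  (ι : AlgebraicClosure K →ₐ[K] AlgebraicClosure ℚ_[p]) (W : WeierstrassCurve K)
  (U : ℕ → Subgroup (Field.absoluteGaloisGroup K)) [hUf : ∀ n, (U n).FiniteIndex] [hUN : ∀ n, (U n).Normal]
  (M : WeierstrassCurve ℤ_[p])
  [hE : (M.map PadicInt.Coe.ringHom).IsElliptic] [hEt : (M.map PadicInt.toZMod).IsElliptic]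

omit hE hEt in
/-- `(M ⊗ ℚ_p) ⊗ ℚ̄_p = M ⊗ ℚ̄_p`. [cite: Kobayashi2003, §2 p. 4] -/
theorem genFibΩ_eq_baseChange : genFibΩ p M = M.baseChange (AlgebraicClosure ℚ_[p]) := by
  rw [genFibΩ, WeierstrassCurve.baseChange, WeierstrassCurve.baseChange, WeierstrassCurve.map_map,
    ← Literature.NumberTheory.EllipticCurves.algebraMap_padicInt_eq, ← IsScalarTower.algebraMap_eq]

variable {W M} in
/-- **The identification `E_Ω-points ≃ E(K̄_{ℚ_p})`** (cc-typer-6's `localPoints W ℚ_[p]`) along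
`(M ⊗ ℚ_p) ⊗ ℚ̄_p = W ⊗ ℚ̄_p`. [cite: Kobayashi2003, §2 p. 4] -/
def toLoc (hV : genFibΩ p M = W.baseChange (AlgebraicClosure ℚ_[p])) :
    (genFibΩ p M).toAffine.Point ≃+ localPoints W ℚ_[p] :=
  ptCast hV

variable {W M} in
omit hE hEt in
/-- The transported Galois action on `E_Ω`-points is coordinatewise. [cite: Kobayashi2003, §2 p. 4] -/
theorem act_some (hV : genFibΩ p M = W.baseChange (AlgebraicClosure ℚ_[p]))
    (σ : Field.absoluteGaloisGroup ℚ_[p]) (x y : PadicAlgCl p) (h : (genFibΩ p M).toAffine.Nonsingular x y) :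
    ∃ h', (toLoc hV).symm (σ • toLoc hV (.some x y h)) = .some (σ • x) (σ • y) h' := by
  have e1 : toLoc hV (.some x y h) =
      (Affine.Point.some x y (hV ▸ h) : (W.baseChange (AlgebraicClosure ℚ_[p])).toAffine.Point) := ptCast_some hV h
  refine ⟨(Affine.baseChange_nonsingular (W := (M.map (PadicInt.Coe.ringHom (p := p))).toAffine)
    (f := ((Field.absoluteGaloisGroup.toAlgEquiv ℚ_[p] σ : PadicAlgCl p ≃ₐ[ℚ_[p]] PadicAlgCl p) :
      PadicAlgCl p →ₐ[ℚ_[p]] PadicAlgCl p)) (AlgEquiv.injective _) x y).mpr h, ?_⟩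
  rw [e1, localPoints.smul_def, Affine.Point.map_some]
  exact ptCast_symm_some hV _

variable {W M} in
omit hE hEt in
/-- The transported action fixes `O`. [cite: Kobayashi2003, §2 p. 4] -/
theorem act_zero (hV : genFibΩ p M = W.baseChange (AlgebraicClosure ℚ_[p])) (σ : Field.absoluteGaloisGroup ℚ_[p]) :
    (toLoc hV).symm (σ • toLoc hV 0) = 0 := by
  rw [map_zero, smul_zero, map_zero]

variable {ι W M} in
omit hE hEt in
/-- **`E(K_{n,v})`-membership is "coordinates in the layer"**: a local point is fixed by `stab p m` iff
its preimage in `E_Ω` has coordinates in `layer p m`. [cite: Kobayashi2003, §2 p. 4] -/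
theorem forall_smul_eq_iff_mem_subfieldPoints (hV : genFibΩ p M = W.baseChange (AlgebraicClosure ℚ_[p]))
    (m : ℕ) (P : localPoints W ℚ_[p]) :
    (∀ τ ∈ stab p m, τ • P = P) ↔
      (toLoc hV).symm P ∈ subfieldPoints (genFibΩ p M) (layer p m).toSubfield coeffs_mem_layer := by
  obtain ⟨Q, rfl⟩ : ∃ Q, P = toLoc hV Q := ⟨(toLoc hV).symm P, ((toLoc hV).apply_symm_apply P).symm⟩
  rw [AddEquiv.symm_apply_apply]
  constructor
  · intro h
    refine mem_subfieldPoints_of_forall_act_eq (fun σ Q' => (toLoc hV).symm (σ • toLoc hV Q')) (act_some hV)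
      fun τ hτ => ?_
    rw [h τ hτ, AddEquiv.symm_apply_apply]
  · intro hQ τ hτ
    rcases Q with _ | ⟨x, y, hxy⟩
    · rw [show (Affine.Point.zero : (genFibΩ p M).toAffine.Point) = 0 from rfl, map_zero, smul_zero]
    · obtain ⟨hx, hy⟩ := (some_mem_subfieldPoints_iff _ hxy).mp hQ
      obtain ⟨h', e⟩ := act_some hV τ x y hxy
      have e' : τ • toLoc hV (.some x y hxy) = toLoc hV (.some (τ • x) (τ • y) h') := by
        rw [← e, AddEquiv.apply_symm_apply]
      rw [e']
      congr 1
      rw [Affine.Point.some.injEq]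
      exact ⟨smul_eq_self_of_mem_stab hτ hx, smul_eq_self_of_mem_stab hτ hy⟩

variable {W M U} in
omit hE hEt hUf hUN in
/-- `E(K_{n,v}) = L(n+1)` under `(U n)_{ℚ_p} = Stab(ζ_{p^{n+1}})`. [cite: Kobayashi2003, §2 p. 4] -/
theorem mem_localFixedPointsOfEmb_iff_mem_subfieldPoints (hV : genFibΩ p M = W.baseChange (AlgebraicClosure ℚ_[p]))
    (hU : ∀ n, localSubgroupOfEmb (U n) ι = stab p (n + 1)) (n : ℕ) (P : localPoints W ℚ_[p]) :
    P ∈ localFixedPointsOfEmb ι W (U n) ↔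
      (toLoc hV).symm P ∈ subfieldPoints (genFibΩ p M) (layer p (n + 1)).toSubfield coeffs_mem_layer := by
  rw [mem_localFixedPointsOfEmb_iff, hU, ← forall_smul_eq_iff_mem_subfieldPoints hV]

variable {W M} in
omit hE hEt in
/-- `E(K_{−1,v}) = E(ℚ_p) = L(0)`. [cite: Kobayashi2003, §2 p. 4] -/
theorem mem_localFixedPointsOfEmb_top_iff_mem_subfieldPoints (hV : genFibΩ p M = W.baseChange (AlgebraicClosure ℚ_[p]))
    (P : localPoints W ℚ_[p]) :
    P ∈ localFixedPointsOfEmb ι W ⊤ ↔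
      (toLoc hV).symm P ∈ subfieldPoints (genFibΩ p M) (layer p 0).toSubfield coeffs_mem_layer := by
  rw [mem_localFixedPointsOfEmb_top_iff, ← forall_smul_eq_iff_mem_subfieldPoints hV 0]
  simp only [stab_zero, Subgroup.mem_top, forall_const]

/-! ## §3 The discharge of `hsum` -/

variable {ι W U M}

end Main

end Literature.NumberTheory.EllipticCurves.Sprung2012.Honda

end Part4

/-!
## Part 5 — port of `Summits/BirchSwinnertonDyer/Rank1Residual/Additive/KobayashiLayerSaturation.lean` (24 declarations kept)

# Prime-to-`p` saturation of `E₁` on the cyclotomic layers (`hsat` DISCHARGED): for a good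
# `ℤ_p`-model `M`, every point of `E(ℚ̄_p)` with coordinates in `ℚ_p(ζ_{p^m})` is killed modulo
# `E₁` by `#Ẽ(𝔽_p)` — reduction modulo the maximal ideal of `𝒪_{ℚ̄_p}` lands in `Ẽ(𝔽_p)`
#

(Port of the declarations listed in the Part header; the source module's docstring — cell bookkeeping of the BSD
printed-inputs programme — is abridged to its title here.)
-/

section Part5

open scoped _root_.Classical _root_.NNReal
open _root_.Polynomial _root_.Finset

namespace Literature.NumberTheory.EllipticCurves.Sprung2012.Honda

open Literature.NumberTheory.EllipticCurves Literature.NumberTheory.GaloisRepresentations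
  Literature.NumberTheory.EllipticCurves.FormalGroupChart _root_.WeierstrassCurve PadicCyclotomicTower BallEval _root_.Field

variable (p : ℕ) [hp : Fact p.Prime]

/-! ## §1 The valuation ring of `ℚ̄_p`, its residue field, and the model over it -/

/-- **The valuation ring `𝒪 = {‖x‖ ≤ 1}` of `Ω = ℚ̄_p`** (Mathlib's `Valuation.valuationSubring` of
the `Valued` structure of `PadicAlgCl p`). [cite: SerreLocalFields1979, Ch. IV §4] -/
abbrev intΩ : ValuationSubring (PadicAlgCl p) := (Valued.v (R := PadicAlgCl p)).valuationSubring

variable {p} in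
/-- Membership in `𝒪`: `‖x‖ ≤ 1`. [cite: SerreLocalFields1979, Ch. IV §4] -/
theorem mem_intΩ_iff (x : PadicAlgCl p) : x ∈ intΩ p ↔ ‖x‖ ≤ 1 := by
  rw [Valuation.mem_valuationSubring_iff, v_le_iff_norm_le, NNReal.coe_one]

/-- `𝒪` is the ring of integers of `v` (the hypothesis `hv` of the tree's reduction files). [cite: SerreLocalFields1979, Ch. IV §4] -/
theorem integers_intΩ : (Valued.v (R := PadicAlgCl p)).Integers (intΩ p) :=
  Valuation.valuationSubring.integers _

/-- **`ℤ_p → 𝒪`** (the structure map `ℤ_p → ℚ_p → Ω`, corestricted). [cite: SerreLocalFields1979, Ch. IV §4] -/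
def padicIntToIntΩ : ℤ_[p] →+* intΩ p :=
  ((algebraMap ℚ_[p] (PadicAlgCl p)).comp (PadicInt.Coe.ringHom (p := p))).codRestrict (intΩ p)
    (fun c => (mem_intΩ_iff _).mpr (by
      rw [RingHom.comp_apply, norm_algebraMap']
      exact PadicInt.norm_le_one c))

/-- `v(p) < 1` on `𝒪`: the residue of `p` vanishes. [cite: SerreLocalFields1979, Ch. IV §4] -/
theorem residue_natCast_prime_eq_zero : IsLocalRing.residue (intΩ p) (p : intΩ p) = 0 := by
  rw [← v_algebraMap_lt_one_iff (integers_intΩ p)]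
  rw [map_natCast]
  exact v_prime_lt_one

/-- **The residue field `k = 𝒪/𝔪` of `ℚ̄_p` has characteristic `p`.** [cite: SerreLocalFields1979, Ch. IV §4] -/
theorem charP_residueField_intΩ : CharP (IsLocalRing.ResidueField (intΩ p)) p := by
  refine ringChar.of_eq (CharP.ringChar_of_prime_eq_zero hp.out ?_)
  have := residue_natCast_prime_eq_zero p
  simpa using this

/-- **`𝔽_p → k`** (`ZMod.castHom` for the characteristic-`p` field `k`). [cite: SerreLocalFields1979, Ch. IV §4] -/
def zmodToResidueΩ : ZMod p →+* IsLocalRing.ResidueField (intΩ p) :=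
  haveI := charP_residueField_intΩ p
  ZMod.castHom (dvd_refl p) _

/-- `𝔽_p → k` on a natural number. [cite: SerreLocalFields1979, Ch. IV §4] -/
@[simp] theorem zmodToResidueΩ_natCast (n : ℕ) : zmodToResidueΩ p (n : ZMod p) = n :=
  map_natCast _ n

/-- `𝔽_p → k` is injective. [cite: SerreLocalFields1979, Ch. IV §4] -/
theorem zmodToResidueΩ_injective : Function.Injective (zmodToResidueΩ p) :=
  (zmodToResidueΩ p).injective

/-- **Residues of `ℤ_p`-elements**: `residue (c) = (c mod p)` read in `k`. [cite: SerreLocalFields1979, Ch. IV §4] -/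
theorem residue_padicIntToIntΩ (c : ℤ_[p]) :
    IsLocalRing.residue (intΩ p) (padicIntToIntΩ p c) = zmodToResidueΩ p (PadicInt.toZMod c) := by
  have h1 : c - (c.zmodRepr : ℤ_[p]) ∈ IsLocalRing.maximalIdeal ℤ_[p] := PadicInt.sub_zmodRepr_mem c
  rw [PadicInt.maximalIdeal_eq_span_p, Ideal.mem_span_singleton] at h1
  obtain ⟨t, ht⟩ := h1
  have hc : c = (c.zmodRepr : ℤ_[p]) + p * t := by rw [← ht]; ring
  have h2 : PadicInt.toZMod c = (c.zmodRepr : ZMod p) := by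
    rw [← ZMod.natCast_zmod_val (PadicInt.toZMod c), PadicInt.val_toZMod_eq_zmodRepr]
  have hp0 : (p : IsLocalRing.ResidueField (intΩ p)) = 0 := by
    have := residue_natCast_prime_eq_zero p
    rwa [map_natCast] at this
  conv_lhs => rw [hc]
  rw [map_add, map_natCast, map_mul, map_natCast, map_add, map_mul, map_natCast, map_natCast,
    hp0, zero_mul, add_zero, h2, zmodToResidueΩ_natCast]

/-- **The model `M ⊗ 𝒪`** of a Weierstrass equation `M/ℤ_p` over the valuation ring of `Ω`. [cite: SerreLocalFields1979, Ch. IV §4] -/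
abbrev modelΩ (M : WeierstrassCurve ℤ_[p]) : WeierstrassCurve (intΩ p) := M.map (padicIntToIntΩ p)

/-- `(M ⊗ 𝒪) ⊗ Ω = E_Ω` (`= (M ⊗ ℚ_p) ⊗ Ω`, the curve `genFibΩ p M` of the series). [cite: SerreLocalFields1979, Ch. IV §4] -/
theorem modelΩ_baseChange (M : WeierstrassCurve ℤ_[p]) :
    (modelΩ p M).baseChange (PadicAlgCl p) = genFibΩ p M := by
  rw [genFibΩ, WeierstrassCurve.baseChange, WeierstrassCurve.baseChange, WeierstrassCurve.map_map,
    WeierstrassCurve.map_map]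
  rfl

/-- **The reduction of `M ⊗ 𝒪` is `(M mod p) ⊗_{𝔽_p} k`.** [cite: SerreLocalFields1979, Ch. IV §4] -/
theorem modelΩ_map_residue (M : WeierstrassCurve ℤ_[p]) :
    (modelΩ p M).map (IsLocalRing.residue (intΩ p)) = (M.map PadicInt.toZMod).map (zmodToResidueΩ p) := by
  rw [WeierstrassCurve.map_map, WeierstrassCurve.map_map]
  congr 1
  ext c
  exact residue_padicIntToIntΩ p c

/-- `Δ(M) ∈ ℤ_p^×` when `M mod p` is an elliptic curve. [cite: SerreLocalFields1979, Ch. IV §4] -/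
theorem isUnit_Δ_of_isElliptic_toZMod (M : WeierstrassCurve ℤ_[p]) [hEt : (M.map PadicInt.toZMod).IsElliptic] :
    IsUnit M.Δ := by
  by_contra h
  have hmem : M.Δ ∈ IsLocalRing.maximalIdeal ℤ_[p] := h
  rw [← PadicInt.ker_toZMod, RingHom.mem_ker] at hmem
  have hu := hEt.isUnit
  rw [WeierstrassCurve.map_Δ, hmem] at hu
  exact not_isUnit_zero hu

/-- `Δ(M ⊗ 𝒪) ∈ 𝒪^×` when `M mod p` is an elliptic curve. [cite: SerreLocalFields1979, Ch. IV §4] -/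
theorem isUnit_Δ_modelΩ (M : WeierstrassCurve ℤ_[p]) [(M.map PadicInt.toZMod).IsElliptic] :
    IsUnit (modelΩ p M).Δ := by
  rw [WeierstrassCurve.map_Δ]
  exact (isUnit_Δ_of_isElliptic_toZMod p M).map _

/-! ## §2 Residues of layer integers lie in `𝔽_p` -/

variable {p}

/-- An integral element of a layer is congruent to an element of `ℤ_p` modulo `𝔪_Ω`: for
`x ∈ ℚ_p(ζ_{p^m})` with `‖x‖ ≤ 1` there is `c ∈ ℚ_p`, `‖c‖ ≤ 1`, with `‖x − c‖ < 1`
(`x = r(ζ − 1)` with `r ∈ ℤ_p[X]`, `c = r(0)`, `‖ζ − 1‖ < 1`). [cite: SerreLocalFields1979, Ch. IV §4] -/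
theorem exists_padic_norm_sub_lt_one {m : ℕ} {x : PadicAlgCl p} (hx : x ∈ layer p m) (hx1 : ‖x‖ ≤ 1) :
    ∃ c : ℚ_[p], ‖c‖ ≤ 1 ∧ ‖x - algebraMap ℚ_[p] (PadicAlgCl p) c‖ < 1 := by
  rcases Nat.eq_zero_or_pos m with rfl | hm
  · rw [layer_zero, IntermediateField.mem_bot] at hx
    obtain ⟨c, rfl⟩ := hx
    refine ⟨c, by rwa [norm_algebraMap'] at hx1, ?_⟩
    rw [sub_self, norm_zero]; exact zero_lt_one
  · obtain ⟨r, -, hr, hrx⟩ := exists_intPoly_aeval_eq p hm hx hx1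
    refine ⟨r.coeff 0, hr 0, ?_⟩
    set π : PadicAlgCl p := zeta p m - 1 with hπ
    have hπ1 : ‖π‖ < 1 := norm_zeta_sub_one_lt_one p hm
    have hπ0 : 0 ≤ ‖π‖ := norm_nonneg _
    -- `x - r(0) = ∑_{j ≥ 1} r_j π^j`
    have hsum : x - algebraMap ℚ_[p] (PadicAlgCl p) (r.coeff 0) =
        ∑ j ∈ range r.natDegree, r.coeff (j + 1) • π ^ (j + 1) := by
      rw [← hrx, aeval_eq_sum_range, sum_range_succ', pow_zero, Algebra.smul_def, mul_one, add_sub_cancel_right]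
    rw [hsum]
    refine lt_of_le_of_lt (IsUltrametricDist.norm_sum_le_of_forall_le_of_nonneg hπ0 fun j _ => ?_) hπ1
    rw [Algebra.smul_def, norm_mul, norm_algebraMap', norm_pow]
    calc ‖r.coeff (j + 1)‖ * ‖π‖ ^ (j + 1) ≤ 1 * ‖π‖ ^ (j + 1) :=
          mul_le_mul_of_nonneg_right (hr _) (pow_nonneg hπ0 _)
      _ = ‖π‖ ^ (j + 1) := one_mul _
      _ ≤ ‖π‖ := pow_le_of_le_one hπ0 hπ1.le (by omega)

/-- **Residues of layer integers lie in `𝔽_p`**: for `x ∈ ℚ_p(ζ_{p^m})` with `‖x‖ ≤ 1` there is a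
natural number `a < p` with `‖x − a‖ < 1` (the residue field of the totally ramified layer is
`𝔽_p`). [cite: SerreLocalFields1979, Ch. IV §4] -/
theorem exists_nat_norm_sub_lt_one {m : ℕ} {x : PadicAlgCl p} (hx : x ∈ layer p m) (hx1 : ‖x‖ ≤ 1) :
    ∃ a : ℕ, a < p ∧ ‖x - a‖ < 1 := by
  obtain ⟨c, hc1, hxc⟩ := exists_padic_norm_sub_lt_one hx hx1
  set c' : ℤ_[p] := ⟨c, hc1⟩ with hc'
  refine ⟨c'.zmodRepr, PadicInt.zmodRepr_lt_p c', ?_⟩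
  have h1 : ‖algebraMap ℚ_[p] (PadicAlgCl p) c - (c'.zmodRepr : PadicAlgCl p)‖ < 1 := by
    have h := PadicInt.norm_sub_zmodRepr_lt_one c'
    rw [← map_natCast (algebraMap ℚ_[p] (PadicAlgCl p)), ← map_sub, norm_algebraMap']
    have e : c - (c'.zmodRepr : ℚ_[p]) = ((c' - (c'.zmodRepr : ℤ_[p]) : ℤ_[p]) : ℚ_[p]) := by
      rw [PadicInt.coe_sub, PadicInt.coe_natCast]
    rw [e]; exact h
  calc ‖x - (c'.zmodRepr : PadicAlgCl p)‖
      = ‖(x - algebraMap ℚ_[p] (PadicAlgCl p) c) + (algebraMap ℚ_[p] (PadicAlgCl p) c - c'.zmodRepr)‖ := by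
        rw [sub_add_sub_cancel]
    _ ≤ max ‖x - algebraMap ℚ_[p] (PadicAlgCl p) c‖ ‖algebraMap ℚ_[p] (PadicAlgCl p) c - c'.zmodRepr‖ :=
        IsUltrametricDist.norm_add_le_max _ _
    _ < 1 := max_lt hxc h1

/-- The residue of a layer integer is the residue of a natural number: for `a : 𝒪` with
`(a : Ω) ∈ ℚ_p(ζ_{p^m})` there is `n : ℕ` with `residue a = n`. [cite: SerreLocalFields1979, Ch. IV §4] -/
theorem exists_residue_eq_natCast {m : ℕ} (a : intΩ p) (ha : (a : PadicAlgCl p) ∈ layer p m) :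
    ∃ n : ℕ, IsLocalRing.residue (intΩ p) a = n := by
  obtain ⟨n, -, hn⟩ := exists_nat_norm_sub_lt_one ha ((mem_intΩ_iff _).mp a.2)
  refine ⟨n, ?_⟩
  rw [← sub_eq_zero, ← map_natCast (IsLocalRing.residue (intΩ p)), ← map_sub,
    ← v_algebraMap_lt_one_iff (integers_intΩ p), v_lt_iff_norm_lt, NNReal.coe_one]
  rw [map_sub, map_natCast]
  exact hn

/-! ## §3 The reduction of a layer point is an `𝔽_p`-point -/

variable (p) in
/-- The coefficients of the reduction `(M ⊗ 𝒪) mod 𝔪 = (M mod p) ⊗ k` lie in the prime field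
`𝔽_p ⊂ k`. [cite: SerreLocalFields1979, Ch. IV §4] -/
theorem coeffs_map_residue_mem_fieldRange (M : WeierstrassCurve ℤ_[p]) :
    ((modelΩ p M).map (IsLocalRing.residue (intΩ p))).a₁ ∈ ((zmodToResidueΩ p).fieldRange : Subfield _) ∧
    ((modelΩ p M).map (IsLocalRing.residue (intΩ p))).a₂ ∈ ((zmodToResidueΩ p).fieldRange : Subfield _) ∧
    ((modelΩ p M).map (IsLocalRing.residue (intΩ p))).a₃ ∈ ((zmodToResidueΩ p).fieldRange : Subfield _) ∧
    ((modelΩ p M).map (IsLocalRing.residue (intΩ p))).a₄ ∈ ((zmodToResidueΩ p).fieldRange : Subfield _) ∧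
    ((modelΩ p M).map (IsLocalRing.residue (intΩ p))).a₆ ∈ ((zmodToResidueΩ p).fieldRange : Subfield _) := by
  rw [modelΩ_map_residue]
  simp only [map_a₁, map_a₂, map_a₃, map_a₄, map_a₆]
  exact ⟨RingHom.mem_fieldRange.mpr ⟨_, rfl⟩, RingHom.mem_fieldRange.mpr ⟨_, rfl⟩, RingHom.mem_fieldRange.mpr ⟨_, rfl⟩,
    RingHom.mem_fieldRange.mpr ⟨_, rfl⟩, RingHom.mem_fieldRange.mpr ⟨_, rfl⟩⟩

variable (p) in
/-- **`Ẽ(𝔽_p) ≤ Ẽ(k)`**: the points of the reduced curve with coordinates in the prime field (the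
`subfieldPoints` of the series for the subfield `𝔽_p = im(𝔽_p → k)`). [cite: SerreLocalFields1979, Ch. IV §4] -/
abbrev primeFieldPoints (M : WeierstrassCurve ℤ_[p]) :
    AddSubgroup ((modelΩ p M).map (IsLocalRing.residue (intΩ p))).toAffine.Point :=
  subfieldPoints ((modelΩ p M).map (IsLocalRing.residue (intΩ p))) (zmodToResidueΩ p).fieldRange
    (coeffs_map_residue_mem_fieldRange p M)

/-- **`#Ẽ(𝔽_p)`, read inside `Ẽ(k)`, is the number of `𝔽_p`-points of `M mod p`**: the map on points
along `𝔽_p → k` is a bijection onto the points with coordinates in the prime field. [cite: SerreLocalFields1979, Ch. IV §4] -/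
theorem natCard_primeFieldPoints (M : WeierstrassCurve ℤ_[p]) :
    Nat.card (primeFieldPoints p M) = Nat.card (M.map PadicInt.toZMod).toAffine.Point := by
  symm
  have hmem : ∀ P : (M.map PadicInt.toZMod).toAffine.Point,
      Affine.Point.congrEquiv (modelΩ_map_residue p M).symm
        ((M.map PadicInt.toZMod).mapPointHom (zmodToResidueΩ p) P) ∈ primeFieldPoints p M := by
    rintro (_ | ⟨a, b, h⟩)
    · rw [← WeierstrassCurve.Affine.Point.zero_def, map_zero, map_zero]; exact (primeFieldPoints p M).zero_mem
    · rw [WeierstrassCurve.mapPointHom_some, Affine.Point.congrEquiv_some, some_mem_subfieldPoints_iff]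
      exact ⟨RingHom.mem_fieldRange.mpr ⟨_, rfl⟩, RingHom.mem_fieldRange.mpr ⟨_, rfl⟩⟩
  refine Nat.card_eq_of_bijective (fun P => ⟨Affine.Point.congrEquiv (modelΩ_map_residue p M).symm
    ((M.map PadicInt.toZMod).mapPointHom (zmodToResidueΩ p) P), hmem P⟩) ⟨?_, ?_⟩
  · intro P₁ P₂ h12
    have h' := congrArg Subtype.val h12
    exact WeierstrassCurve.mapPointHom_injective _ _
      ((Affine.Point.congrEquiv (modelΩ_map_residue p M).symm).injective h')
  · rintro ⟨R, hR⟩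
    rcases R with _ | ⟨x, y, h⟩
    · exact ⟨0, Subtype.ext (by simp only [map_zero]; rfl)⟩
    · obtain ⟨hx, hy⟩ := (some_mem_subfieldPoints_iff _ h).mp hR
      obtain ⟨a, rfl⟩ := RingHom.mem_fieldRange.mp hx
      obtain ⟨b, rfl⟩ := RingHom.mem_fieldRange.mp hy
      have h' : ((M.map PadicInt.toZMod).map (zmodToResidueΩ p)).toAffine.Nonsingular
          (zmodToResidueΩ p a) (zmodToResidueΩ p b) := by
        rw [← modelΩ_map_residue]; exact h
      have h₀ : (M.map PadicInt.toZMod).toAffine.Nonsingular a b :=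
        (Affine.map_nonsingular _ (zmodToResidueΩ_injective p) _ _).mp h'
      refine ⟨.some a b h₀, Subtype.ext ?_⟩
      simp only
      rw [WeierstrassCurve.mapPointHom_some, Affine.Point.congrEquiv_some]

/-- **Lagrange in `Ẽ(𝔽_p)`**: a point of `Ẽ(k)` with coordinates in the prime field is killed by
`#Ẽ(𝔽_p)`. [cite: SerreLocalFields1979, Ch. IV §4] -/
theorem natCard_smul_eq_zero_of_mem_primeFieldPoints (M : WeierstrassCurve ℤ_[p])
    {R : ((modelΩ p M).map (IsLocalRing.residue (intΩ p))).toAffine.Point} (hR : R ∈ primeFieldPoints p M) :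
    Nat.card (M.map PadicInt.toZMod).toAffine.Point • R = 0 := by
  have h := card_nsmul_eq_zero' (G := primeFieldPoints p M) (x := ⟨R, hR⟩)
  rw [natCard_primeFieldPoints] at h
  exact congrArg Subtype.val h

/-- **The reduction of a point with coordinates in a layer is an `𝔽_p`-point.** For `M/ℤ_p` with
`M mod p` elliptic and `Q ∈ E_Ω` with coordinates in `ℚ_p(ζ_{p^m})`, the reduction of `Q` (read on
`M ⊗ 𝒪`, Silverman VII.2.1) has coordinates in the prime field of `k`.
[cite: SilvermanAEC2009, VII.2 Prop. 2.1] [cite: Kobayashi2003, §8.4 (proof of Prop. 8.12)] -/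
theorem goodReductionHom_mem_primeFieldPoints (M : WeierstrassCurve ℤ_[p]) [(M.map PadicInt.toZMod).IsElliptic]
    {m : ℕ} {Q : (genFibΩ p M).toAffine.Point}
    (hQ : Q ∈ subfieldPoints (genFibΩ p M) (layer p m).toSubfield coeffs_mem_layer) :
    goodReductionHom (modelΩ p M) (integers_intΩ p) (isUnit_Δ_modelΩ p M)
        (Affine.Point.congrEquiv (modelΩ_baseChange p M).symm Q) ∈ primeFieldPoints p M := by
  have hv := integers_intΩ p
  have hΔ := isUnit_Δ_modelΩ p M
  set Q' := Affine.Point.congrEquiv (modelΩ_baseChange p M).symm Q with hQ'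
  rcases point_cases (W := modelΩ p M) hv Q' with h0 | ⟨x, y, h, hxy, hx⟩ | ⟨a, b, h, hab⟩
  · rw [h0, map_zero]; exact (primeFieldPoints p M).zero_mem
  · rw [hxy, goodReductionHom_apply, WeierstrassCurve.reducePoint_some_of_not_mem h ((not_mem_range_iff hv).mpr hx)]
    exact (primeFieldPoints p M).zero_mem
  · -- the coordinates `a, b` of `Q` lie in the layer
    have hQab : Q = Affine.Point.congrEquiv (modelΩ_baseChange p M) (.some _ _ h) := by
      rw [← hab, hQ', WeierstrassCurve.congrEquiv_apply_congrEquiv_symm]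
    have hmem := hQ _ _ _ (by rw [hQab, Affine.Point.congrEquiv_some])
    obtain ⟨na, hna⟩ := exists_residue_eq_natCast a hmem.1
    obtain ⟨nb, hnb⟩ := exists_residue_eq_natCast b hmem.2
    have hns : ((modelΩ p M).map (IsLocalRing.residue (intΩ p))).toAffine.Nonsingular
        (IsLocalRing.residue (intΩ p) a) (IsLocalRing.residue (intΩ p) b) :=
      (WeierstrassCurve.hasNonsingularReduction_some_algebraMap_iff hv.hom_inj h).mp
        (hasNonsingularReduction_of_isUnit_Δ hv hΔ _)
    rw [hab, goodReductionHom_apply, WeierstrassCurve.reducePoint_some_algebraMap hv.hom_inj h hns,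
      some_mem_subfieldPoints_iff, hna, hnb]
    exact ⟨RingHom.mem_fieldRange.mpr ⟨na, map_natCast _ na⟩, RingHom.mem_fieldRange.mpr ⟨nb, map_natCast _ nb⟩⟩

/-! ## §4 `#Ẽ(𝔽_p) • Q ∈ E₁` and the `hsat` hypothesis -/

/-- **Prime-to-`p` saturation: `#Ẽ(𝔽_p) • Q ∈ E₁` for every point `Q ∈ E_Ω` with coordinates in a
layer `ℚ_p(ζ_{p^m})`** (`M mod p` elliptic): the reduction of `Q` lies in the finite group
`Ẽ(𝔽_p)`, which is killed by its order, and the kernel of reduction is `E₁ = {‖x‖ > 1} ∪ {O}`.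
[cite: SilvermanAEC2009, VII.2 Prop. 2.1] [cite: Kobayashi2003, §8.4 (proof of Prop. 8.12)] -/
theorem card_smul_mem_kernel_of_mem_subfieldPoints (M : WeierstrassCurve ℤ_[p]) [(M.map PadicInt.toZMod).IsElliptic]
    {m : ℕ} {Q : (genFibΩ p M).toAffine.Point}
    (hQ : Q ∈ subfieldPoints (genFibΩ p M) (layer p m).toSubfield coeffs_mem_layer) :
    haveI := isIntegral_genFib_baseChange p M
    Nat.card (M.map PadicInt.toZMod).toAffine.Point • Q ∈ kernel (Valued.v (R := PadicAlgCl p)) (genFibΩ p M) := by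
  have hv := integers_intΩ p
  have hΔ := isUnit_Δ_modelΩ p M
  set N := Nat.card (M.map PadicInt.toZMod).toAffine.Point with hN
  set e := Affine.Point.congrEquiv (modelΩ_baseChange p M).symm with he
  have hred : goodReductionHom (modelΩ p M) hv hΔ (e (N • Q)) = 0 := by
    rw [map_nsmul, map_nsmul, hN]
    exact natCard_smul_eq_zero_of_mem_primeFieldPoints M (goodReductionHom_mem_primeFieldPoints M hQ)
  have hker : WeierstrassCurve.ReducesToZero (modelΩ p M) (e (N • Q)) :=
    (goodReductionHom_eq_zero_iff hv hΔ _).mp hred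
  -- read on `E_Ω`
  intro x y hxy hNQ
  rw [hNQ, he, Affine.Point.congrEquiv_some, WeierstrassCurve.reducesToZero_some_iff, not_mem_range_iff hv] at hker
  exact hker

section Hsat

variable {K : Type} [Field K] [Algebra K ℚ_[p]]
  (ι : AlgebraicClosure K →ₐ[K] AlgebraicClosure ℚ_[p]) (W : WeierstrassCurve K)
  (U : ℕ → Subgroup (Field.absoluteGaloisGroup K))
  (M : WeierstrassCurve ℤ_[p]) [hEt : (M.map PadicInt.toZMod).IsElliptic]

variable {ι W U M}

end Hsat

end Literature.NumberTheory.EllipticCurves.Sprung2012.Honda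

end Part5

/-!
## Part 6 — port of `Summits/BirchSwinnertonDyer/Rank1Residual/Additive/CyclotomicTowerLocalTorsionPadic.lean` (2 declarations kept)

# Prop. 8.7 DISCHARGED at `E = ℚ_p` for good supersingular `p ≥ 3`: no `p`-power torsion in
# `E(K_{n,v})` at ANY layer of the tower `K₀·K_n^κ` when `[K₀ : K] < (p² − 1)/2` — the `htors`
# hypothesis of files 1–5 of this series (p312958 / p313494 / p314385 / p314968 / p315764) REMOVED;
# hence `E⁺(K_{n,v}) ∩ E⁻(K_{n,v}) = E(K_{−1,v})` UNCONDITIONALLY and transversality (T) from `hsum`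
# alone

(Port of the declarations listed in the Part header; the source module's docstring — cell bookkeeping of the BSD
printed-inputs programme — is abridged to its title here.)
-/

section Part6

open scoped _root_.Classical

universe u

namespace Literature.NumberTheory.EllipticCurves.Sprung2012.Honda

open Literature.NumberTheory.EllipticCurves Literature.NumberTheory.GaloisRepresentations
  Literature.NumberTheory.EllipticCurves.Kobayashi2003 ZpExtension

/-! ## §1 The local index divides the global one -/

section Index

variable {K : Type u} [Field K] {E : Type u} [Field E] [Algebra K E]
  (ι : AlgebraicClosure K →ₐ[K] AlgebraicClosure E)

/-- **`[Γ_E : H_E] ∣ [Γ_K : H]` for `H` normal** (`H_E = (Γ_E → Γ_K)⁻¹(H)`, `Subgroup.index_comap`,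
`relIndex_dvd_index_of_normal`): the local degree `[L_w : K_v]` divides `[L : K]` for `L/K`
Galois. Serre, *Galois Cohomology*, II.§1.1. [cite: SerreGaloisCohomology1997, II.§1.1] -/
theorem index_localSubgroupOfEmb_dvd (H : Subgroup (Field.absoluteGaloisGroup K)) [H.Normal] :
    (localSubgroupOfEmb H ι).index ∣ H.index := by
  unfold localSubgroupOfEmb
  rw [Subgroup.index_comap]
  exact Subgroup.relIndex_dvd_index_of_normal _ _

end Index

/-! ## §2 `E(L_w)[p] = 0` at `E = ℚ_p` for small local degree, good supersingular `p` -/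

section Padic

variable {p : ℕ} [hp : Fact p.Prime] {K : Type} [Field K] [Algebra K ℚ_[p]]
  (ι : AlgebraicClosure K →ₐ[K] AlgebraicClosure ℚ_[p]) (W : WeierstrassCurve K)

/-- **`E(L_w)[p] = 0` when `[L_w : ℚ_p] < (p² − 1)/2`, good supersingular `p ≥ 3`.** For
`H ≤ Γ_K` whose local subgroup `H_{ℚ_p} ≤ Γ_{ℚ_p}` has finite index `< (p² − 1)/2`, and `W/K` with a
good supersingular model `M/ℤ_p` (`Δ(M)` a unit, `A_p(M) ∈ pℤ_p`, `M ⊗ ℚ̄_p = W ⊗ ℚ̄_p`): the points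
of `W(ℚ̄_p)` fixed by `H_{ℚ_p}` have no element of order `p` — a fixed point `(x, y)` has `σ x = x`
for `σ ∈ H_{ℚ_p}`, and the Literature theorem `prime_smul_some_ne_zero_of_forall_apply_eq`
(Serre 1972 §1.11 Prop. 12: `deg_{ℚ_p} x(P) ≥ (p² − 1)/2` on `E[p] ∖ 0`) applies.
[cite: SerreInventiones1972, §1.11 Prop. 12] [cite: Kobayashi2003, Prop. 8.7 (p. 16)] -/
theorem eq_zero_of_prime_smul_eq_zero_localFixedPointsOfEmb_padic (hp2 : p ≠ 2)
    (M : WeierstrassCurve ℤ_[p]) (hΔ : IsUnit M.Δ)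
    (hA : M.hasseCoeff p ∈ IsLocalRing.maximalIdeal ℤ_[p])
    (hWM : M.baseChange (AlgebraicClosure ℚ_[p]) = W.baseChange (AlgebraicClosure ℚ_[p]))
    (H : Subgroup (Field.absoluteGaloisGroup K))
    (hH0 : (localSubgroupOfEmb H ι).index ≠ 0) (hH : (localSubgroupOfEmb H ι).index < (p ^ 2 - 1) / 2) :
    ∀ Q ∈ localFixedPointsOfEmb ι W H, p • Q = 0 → Q = 0 := by
  intro Q hQ hpQ
  rw [mem_localFixedPointsOfEmb_iff] at hQ
  change (W.baseChange (AlgebraicClosure ℚ_[p])).toAffine.Point at Q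
  rcases Q with _ | ⟨x, y, hxy⟩
  · rfl
  exfalso
  have hfix : ∀ σ ∈ localSubgroupOfEmb H ι,
      (show AlgebraicClosure ℚ_[p] ≃ₐ[ℚ_[p]] AlgebraicClosure ℚ_[p] from σ) x = x := by
    intro σ hσ
    have h := hQ σ hσ
    rw [localPoints.smul_def, WeierstrassCurve.Affine.Point.map_some] at h
    exact (WeierstrassCurve.Affine.Point.some.inj h).1
  exact prime_smul_some_ne_zero_of_forall_apply_eq hp2 M hΔ hA hWM (localSubgroupOfEmb H ι) hH0 hH
    hfix hpQ

end Padic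

/-! ## §3 cc-typer-6's tower at `E = ℚ_p`: Prop. 8.7 at every layer, the intersection identity and
transversality with NO torsion hypothesis -/

section Tower

variable {p : ℕ} [hp : Fact p.Prime] {K : Type} [Field K] [Algebra K ℚ_[p]] (κ : ZpExtension K p)
  (K₀ : Type) [Field K₀] [Algebra K K₀] [(galRange (K := K) K₀).Normal]
  (ι : AlgebraicClosure K →ₐ[K] AlgebraicClosure ℚ_[p]) (W : WeierstrassCurve K) [W.IsElliptic]

variable [NumberField K] [NumberField K₀]

end Tower

end Literature.NumberTheory.EllipticCurves.Sprung2012.Honda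

end Part6

/-!
## Part 7 — port of `Summits/BirchSwinnertonDyer/Rank1Residual/Additive/KobayashiSignedGenerationOfStab.lean` (3 declarations kept)

# `hsum` under the SINGLE structural hypothesis `(U n)_{ℚ_p} = Stab(ζ_{p^{n+1}})`: the torsion
# hypothesis `htors` (Prop. 8.7, by gen 32's descent + Serre's degree bound at the bottom layer
# `ℚ_p(μ_p)`) and the saturation hypothesis `hsat` (file KobayashiLayerSaturation) of
# `localFixedPointsOfEmb_le_sup_towerSigned` are DISCHARGED for every such tower
#

(Port of the declarations listed in the Part header; the source module's docstring — cell bookkeeping of the BSD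
printed-inputs programme — is abridged to its title here.)
-/

section Part7

open scoped _root_.Classical

namespace Literature.NumberTheory.EllipticCurves.Sprung2012.Honda

open Literature.NumberTheory.EllipticCurves Literature.NumberTheory.GaloisRepresentations
  _root_.WeierstrassCurve PadicCyclotomicTower BallEval _root_.Field

variable {p : ℕ} [hp : Fact p.Prime]

/-! ## §1 `a_p = 0 ⟹ A_p ∈ pℤ_p` -/

/-- **`[Stab(ζ_{p^{m+1}}) : Stab(ζ_{p^{n+1}})] ∣ pⁿ`** for `m ≤ n` (it equals `p^{n−m}`:
`φ(p^{n+1}) = p^{n−m} φ(p^{m+1})`). [cite: SerreLocalFields1979, Ch. IV §4] -/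
theorem index_subgroupOf_stab_succ_dvd_pow {m n : ℕ} (hmn : m ≤ n) :
    ((stab p (n + 1)).subgroupOf (stab p (m + 1))).index ∣ p ^ n := by
  have hle : stab p (n + 1) ≤ stab p (m + 1) := stab_antitone p (by omega)
  have h := Subgroup.relIndex_mul_index hle
  rw [index_stab', index_stab', Nat.totient_prime_pow_succ hp.out, Nat.totient_prime_pow_succ hp.out] at h
  have hpos : 0 < p ^ m * (p - 1) := Nat.mul_pos (pow_pos hp.out.pos m) (Nat.sub_pos_of_lt hp.out.one_lt)
  have hrel : (stab p (n + 1)).relIndex (stab p (m + 1)) = p ^ (n - m) := by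
    refine Nat.eq_of_mul_eq_mul_right hpos ?_
    rw [h, ← mul_assoc, ← pow_add, Nat.sub_add_cancel hmn]
  change (stab p (n + 1)).relIndex (stab p (m + 1)) ∣ p ^ n
  rw [hrel]
  exact pow_dvd_pow p (Nat.sub_le n m)

/-- `[Γ_{ℚ_p} : Stab(ζ_p)] = p − 1` is non-zero and `< (p² − 1)/2` for `p` odd. [cite: Kobayashi2003, Prop. 8.12] -/
theorem index_stab_one_ne_zero_and_lt (hp2 : p ≠ 2) :
    (stab p 1).index ≠ 0 ∧ (stab p 1).index < (p ^ 2 - 1) / 2 := by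
  rw [index_stab', pow_one, Nat.totient_prime hp.out]
  have h3 : 3 ≤ p := by
    rcases hp.out.eq_two_or_odd' with h | h
    · exact absurd h hp2
    · have := hp.out.two_le; rcases h with ⟨k, hk⟩; omega
  have h9 : 3 * p ≤ p ^ 2 := by rw [sq]; exact Nat.mul_le_mul_right p h3
  constructor <;> omega

section Tower

variable {K : Type} [Field K] [Algebra K ℚ_[p]]
  (ι : AlgebraicClosure K →ₐ[K] AlgebraicClosure ℚ_[p]) (W : WeierstrassCurve K) [W.IsElliptic]
  (U : ℕ → Subgroup (Field.absoluteGaloisGroup K)) [hUN : ∀ n, (U n).Normal]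

/-- **Prop. 8.7 for EVERY tower with `(U n)_{ℚ_p} = Stab(ζ_{p^{n+1}})`**: for `W/K` elliptic with a
good supersingular `ℤ_p`-model `M` (`Δ(M) ∈ ℤ_p^×`, `A_p(M) ∈ pℤ_p`, `M ⊗ ℚ̄_p = W ⊗ ℚ̄_p`), `p` odd,
and `U n ⊴ Γ_K` with local subgroups the stabilisers of `ζ_{p^{n+1}}`: `E(K_{n,v})[p^k] = 0` for all
`n, k` — the bottom layer `K_{0,v} = ℚ_p(μ_p)` has degree `p − 1 < (p² − 1)/2` (gen 32,
`eq_zero_of_prime_smul_eq_zero_localFixedPointsOfEmb_padic`, Serre 1972 Prop. 12), and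
`[K_{n,v} : K_{0,v}] = pⁿ` feeds the `p`-group descent
(`eq_zero_of_prime_smul_eq_zero_localFixedPointsOfEmb_tower`). [cite: Kobayashi2003, Prop. 8.7 (p. 16)]
[cite: SerreInventiones1972, §1.11 Prop. 12] -/
theorem eq_zero_of_prime_pow_smul_eq_zero_localFixedPointsOfEmb_of_stab (hp2 : p ≠ 2)
    (M : WeierstrassCurve ℤ_[p]) (hΔ : IsUnit M.Δ) (hA : M.hasseCoeff p ∈ IsLocalRing.maximalIdeal ℤ_[p])
    (hWM : M.baseChange (AlgebraicClosure ℚ_[p]) = W.baseChange (AlgebraicClosure ℚ_[p]))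
    (hU : ∀ n, localSubgroupOfEmb (U n) ι = stab p (n + 1)) (n k : ℕ) :
    ∀ Q ∈ localFixedPointsOfEmb ι W (U n), p ^ k • Q = 0 → Q = 0 := by
  have h₀ : ∀ Q ∈ localFixedPointsOfEmb ι W (U 0), p • Q = 0 → Q = 0 := by
    obtain ⟨h0, hlt⟩ := index_stab_one_ne_zero_and_lt (p := p) hp2
    refine eq_zero_of_prime_smul_eq_zero_localFixedPointsOfEmb_padic ι W hp2 M hΔ hA hWM (U 0) ?_ ?_
    · rw [hU 0]; exact h0
    · rw [hU 0]; exact hlt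
  have hn : ∀ Q ∈ localFixedPointsOfEmb ι W (U n), p • Q = 0 → Q = 0 :=
    eq_zero_of_prime_smul_eq_zero_localFixedPointsOfEmb_tower ι W U n
      (fun m hm => ⟨n, by rw [hU n, hU m]; exact index_subgroupOf_stab_succ_dvd_pow hm⟩) h₀
  exact eq_zero_of_pow_smul_eq_zero_of_forall _ hn k

variable [hUf : ∀ n, (U n).FiniteIndex] (M : WeierstrassCurve ℤ_[p])
  [hE : (M.map PadicInt.Coe.ringHom).IsElliptic] [hEt : (M.map PadicInt.toZMod).IsElliptic]

variable {ι W U M}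

/-! ## §3 `hsum` with NO torsion and NO saturation hypothesis -/

end Tower

end Literature.NumberTheory.EllipticCurves.Sprung2012.Honda

end Part7

/-!
## Part 8 — port of `Summits/BirchSwinnertonDyer/Rank1Residual/Additive/CyclotomicTowerLocalStab.lean` (10 declarations kept)

# F9, the identification of the LOCAL tower: for the cyclotomic `ℤ_p`-extension `κ` and
# `K₀ ⊇ μ_p` of degree `≤ p − 1`, the local subgroup of `Gal(K̄/K₀·K_n^κ)` at `ι : K̄ → ℚ̄_p` IS the
# stabiliser of `ζ_{p^{n+1}}` — `(towerSubgroup κ K₀ n)_{ℚ_p} = Stab(ζ_{p^{n+1}})`, i.e.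
# `K_{n,v} = ℚ_p(ζ_{p^{n+1}})`

(Port of the declarations listed in the Part header; the source module's docstring — cell bookkeeping of the BSD
printed-inputs programme — is abridged to its title here.)
-/

section Part8

open scoped _root_.Classical

namespace Literature.NumberTheory.EllipticCurves.Sprung2012.Honda

open Literature.NumberTheory.EllipticCurves Literature.NumberTheory.GaloisRepresentations
  Literature.NumberTheory.EllipticCurves.CyclotomicZp ZpExtension PadicCyclotomicTower _root_.Field

variable {p : ℕ} [hp : Fact p.Prime]

/-! ## §1 No `p`-torsion in `1 + pℤ_p` -/

/-- **A unit of `ℤ_p` of finite order which is `≡ 1 (mod p)` is `1`** (`p` odd): the torsion of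
`ℤ_pˣ` is `μ_{p−1}` (`ker ℓ`, `ℓ` the normalised logarithm of file CyclotomicZpExtension, so
`u^{p−1} = 1`), and a `(p−1)`-th root of unity `≡ 1 (mod p)` is `1`. [cite: Washington1997, §13.1] -/
theorem eq_one_of_isOfFinOrder_of_toZMod_eq_one (hp2 : p ≠ 2) {u : ℤ_[p]ˣ} (hu : IsOfFinOrder u)
    (h1 : PadicInt.toZMod (u : ℤ_[p]) = 1) : u = 1 := by
  have ht : ell p u = 0 := (ell_eq_zero_iff p u).mpr hu
  have hpow : (u : ℤ_[p]) ^ torsionOrder p = 1 := by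
    have h := cycPow_torsionOrder_mul_ell p u
    rw [ht, mul_zero, AddChar.map_zero_eq_one] at h
    exact h.symm
  have htor : torsionOrder p = p - 1 := by
    unfold torsionOrder cyclotomicExponent
    rw [if_neg hp2, pow_one, Nat.totient_prime hp.out]
  rw [htor] at hpow
  exact Units.ext (Kato2004.eq_one_of_pow_sub_one_eq_one_of_toZMod_eq_one p hpow h1)

/-- `ζ^a = ζ^b ↔ a ≡ b (mod k)` for a primitive `k`-th root of unity `ζ` (`k ≠ 0`) in a
commutative monoid (through the unit group, Mathlib `pow_eq_pow_iff_modEq`). [cite: Washington1997, §13.1] -/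
theorem pow_eq_pow_iff_modEq_of_isPrimitiveRoot {M : Type*} [CommMonoid M] {ζ : M} {k : ℕ}
    (hζ : IsPrimitiveRoot ζ k) (hk : k ≠ 0) {a b : ℕ} : ζ ^ a = ζ ^ b ↔ a ≡ b [MOD k] := by
  obtain ⟨u, rfl⟩ := hζ.isUnit hk
  rw [← Units.val_pow_eq_pow_val, ← Units.val_pow_eq_pow_val, Units.val_inj, pow_eq_pow_iff_modEq,
    ← (IsPrimitiveRoot.coe_units_iff.mp hζ).eq_orderOf]

/-! ## §2 GLOBAL: `towerSubgroup κ K₀ n` fixes the `p^{n+1}`-th roots of unity -/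

section Global

variable {K : Type} [Field K] [NumberField K] (κ : ZpExtension K p)
  (K₀ : Type) [Field K₀] [NumberField K₀] [Algebra K K₀]

omit [NumberField K] [NumberField K₀] in
/-- **`κ(Gal(K̄/K₀)) = ℤ_p`** when `[Γ_K : Gal(K̄/K₀)]` is prime to `p`: the image has index dividing
that index, and a subgroup of `ℤ_p` of index `d` prime to `p` is everything (`d` is a unit).
[cite: Washington1997, §13.1] -/
theorem exists_mem_galRange_apply_eq (hidx : ¬ p ∣ (galRange (K := K) K₀).index) (a : ℤ_[p]) :
    ∃ ρ ∈ galRange (K := K) K₀, κ ρ = Multiplicative.ofAdd a := by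
  set S : Subgroup (Multiplicative ℤ_[p]) := (galRange (K := K) K₀).map κ.toContinuousMonoidHom.toMonoidHom
    with hS
  have hdvd : S.index ∣ (galRange (K := K) K₀).index := Subgroup.index_map_dvd _ κ.surjective
  have hSp : ¬ p ∣ S.index := fun h => hidx (h.trans hdvd)
  -- `S.index` is a unit of `ℤ_p`
  have hunit : IsUnit ((S.index : ℕ) : ℤ_[p]) := by
    rw [PadicInt.isUnit_iff, PadicInt.norm_natCast_eq_one_iff]
    exact (Nat.Prime.coprime_iff_not_dvd hp.out).mpr hSp
  obtain ⟨t, ht⟩ := hunit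
  have hmem : Multiplicative.ofAdd a ∈ S := by
    have h := Subgroup.pow_index_mem S (Multiplicative.ofAdd ((↑t⁻¹ : ℤ_[p]) * a))
    rwa [← ofAdd_nsmul, nsmul_eq_mul, ← ht, ← mul_assoc, Units.mul_inv, one_mul] at h
  obtain ⟨ρ, hρ, hρa⟩ := Subgroup.mem_map.mp hmem
  exact ⟨ρ, hρ, hρa⟩

/-- **Elements of `Gal(K̄/K₀)` fix the `p`-th roots of unity of `K̄`** when `K₀` contains a primitive
`p`-th root of unity `z` (its image `j(z) ∈ K̄` is fixed, and every `p`-th root of unity is a power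
of it). [cite: Kobayashi2003, §2 p. 4 (K₀ = ℚ(μ_p))] -/
theorem smul_eq_self_of_mem_galRange_of_pow_eq_one (hz : ∃ z : K₀, IsPrimitiveRoot z p)
    {σ : Field.absoluteGaloisGroup K} (hσ : σ ∈ galRange (K := K) K₀) {t : AlgebraicClosure K}
    (ht : t ^ p = 1) : σ • t = t := by
  obtain ⟨z, hzp⟩ := hz
  have hζ : IsPrimitiveRoot (embIntoClosure (K := K) K₀ z) p :=
    hzp.map_of_injective (embIntoClosure (K := K) K₀).injective
  obtain ⟨i, -, rfl⟩ := hζ.eq_pow_of_pow_eq_one ht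
  rw [smul_pow']
  congr 1
  exact smul_embIntoClosure_of_mem_galRange K₀ hσ z

/-- **`ρ ∈ Gal(K̄/K₀) ⟹ ρ^{pⁿ}` fixes every `p^{n+1}`-th root of unity** (`K₀ ⊇ μ_p`): `ρ` acts on
`μ_{p^{n+1}}` by `χ(ρ) ≡ 1 (mod p)` (it fixes `ζ^{pⁿ} ∈ μ_p`), and `c ≡ 1 (mod p) ⟹ c^{pⁿ} ≡ 1 (mod p^{n+1})`
(Mathlib `dvd_sub_pow_of_dvd_sub`). [cite: Washington1997, §13.1] -/
theorem pow_smul_eq_self_of_mem_galRange (hz : ∃ z : K₀, IsPrimitiveRoot z p)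
    {ρ : Field.absoluteGaloisGroup K} (hρ : ρ ∈ galRange (K := K) K₀) (n : ℕ)
    {ζ : AlgebraicClosure K} (hζ : IsPrimitiveRoot ζ (p ^ (n + 1))) : ρ ^ p ^ n • ζ = ζ := by
  set c : ℕ := ((GaloisRep.cyclotomicCharacter K p ρ).val.toZModPow (n + 1)).val with hc
  have hρζ : ρ • ζ = ζ ^ c := GaloisRep.cyclotomicCharacter_spec K p ρ ζ hζ.pow_eq_one
  -- `ρ^j • ζ = ζ^(c^j)`
  have hiter : ∀ j : ℕ, ρ ^ j • ζ = ζ ^ c ^ j := by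
    intro j
    induction j with
    | zero => rw [pow_zero, one_smul, pow_zero, pow_one]
    | succ j ih => rw [pow_succ, mul_smul, hρζ, smul_pow', ih, ← pow_mul, ← pow_succ]
  rw [hiter]
  -- `c ≡ 1 (mod p)`: `ρ` fixes the primitive `p`-th root `ζ^{pⁿ}`
  have hζp : IsPrimitiveRoot (ζ ^ p ^ n) p := by
    have := hζ.pow_of_dvd (pow_ne_zero n hp.out.ne_zero) (pow_dvd_pow p (Nat.le_succ n))
    rwa [pow_succ, Nat.mul_div_cancel_left p (pow_pos hp.out.pos n)] at this
  have hfix : ρ • ζ ^ p ^ n = ζ ^ p ^ n :=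
    smul_eq_self_of_mem_galRange_of_pow_eq_one K₀ hz hρ hζp.pow_eq_one
  rw [smul_pow', hρζ, ← pow_mul, mul_comm, pow_mul] at hfix
  -- `(ζ^{pⁿ})^c = ζ^{pⁿ}` ⟹ `c ≡ 1 [MOD p]`
  have hc1 : c ≡ 1 [MOD p] := by
    have h : (ζ ^ p ^ n) ^ c = (ζ ^ p ^ n) ^ 1 := by rw [pow_one]; exact hfix
    exact (pow_eq_pow_iff_modEq_of_isPrimitiveRoot hζp hp.out.ne_zero).mp h
  -- `c^{pⁿ} ≡ 1 [MOD p^{n+1}]`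
  have hdvd : ((p ^ (n + 1) : ℕ) : ℤ) ∣ (c : ℤ) ^ p ^ n - 1 ^ p ^ n :=
    dvd_sub_pow_of_dvd_sub (R := ℤ) (p := p) (a := (c : ℤ)) (b := 1)
      (by have := (Nat.modEq_iff_dvd.mp hc1.symm); simpa using this) n
  have hmod : c ^ p ^ n ≡ 1 [MOD p ^ (n + 1)] := by
    refine (Nat.modEq_iff_dvd.mpr ?_).symm
    push_cast
    rw [one_pow] at hdvd
    exact hdvd
  have h : ζ ^ c ^ p ^ n = ζ ^ 1 :=
    (pow_eq_pow_iff_modEq_of_isPrimitiveRoot hζ (pow_ne_zero _ hp.out.ne_zero)).mpr hmod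
  rw [h, pow_one]

variable {κ} in
/-- **`k ∈ ker κ ∩ Gal(K̄/K₀)` fixes every `p`-power root of unity** (`κ` cyclotomic, `K₀ ⊇ μ_p`,
`p` odd): `χ(k)` has finite order (`ker κ = χ⁻¹(μ(ℤ_p))`) and is `≡ 1 (mod p)` (`k` fixes `μ_p`), so
`χ(k) = 1` (§1). [cite: Washington1997, §13.1] -/
theorem smul_eq_self_of_mem_kerSubgroup_of_mem_galRange (hp2 : p ≠ 2) (hκ : κ.IsCyclotomic)
    (hz : ∃ z : K₀, IsPrimitiveRoot z p) {k : Field.absoluteGaloisGroup K} (hk : k ∈ κ.kerSubgroup)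
    (hk₀ : k ∈ galRange (K := K) K₀) {m : ℕ} {ζ : AlgebraicClosure K} (hζ : ζ ^ p ^ m = 1) : k • ζ = ζ := by
  -- `χ(k)` is torsion
  have htor : IsOfFinOrder (GaloisRep.cyclotomicCharacter K p k) := by
    rw [show κ.kerSubgroup = _ from hκ, Subgroup.mem_comap, CommGroup.mem_torsion] at hk
    exact hk
  -- `χ(k) ≡ 1 (mod p)`: `k` fixes a primitive `p`-th root of unity
  haveI : NeZero ((p : ℕ) : AlgebraicClosure K) := ⟨by exact_mod_cast hp.out.ne_zero⟩
  obtain ⟨t, ht⟩ := HasEnoughRootsOfUnity.exists_primitiveRoot (AlgebraicClosure K) p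
  have hkt : k • t = t := smul_eq_self_of_mem_galRange_of_pow_eq_one K₀ hz hk₀ ht.pow_eq_one
  have hspec := GaloisRep.cyclotomicCharacter_spec K p (k := 1) k t (by rw [pow_one]; exact ht.pow_eq_one)
  rw [hkt] at hspec
  have h1 : PadicInt.toZMod ((GaloisRep.cyclotomicCharacter K p k : ℤ_[p]ˣ) : ℤ_[p]) = 1 := by
    set x : ZMod (p ^ 1) := (GaloisRep.cyclotomicCharacter K p k).val.toZModPow 1 with hx
    have hmod : 1 ≡ x.val [MOD p] := by
      have h : t ^ 1 = t ^ x.val := by rw [pow_one]; exact hspec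
      exact (pow_eq_pow_iff_modEq_of_isPrimitiveRoot ht hp.out.ne_zero).mp h
    have hlt : x.val < p := lt_of_lt_of_eq (ZMod.val_lt x) (pow_one p)
    have hxval : x.val = 1 := by
      have h : 1 % p = x.val % p := hmod
      rwa [Nat.mod_eq_of_lt hp.out.one_lt, Nat.mod_eq_of_lt hlt, eq_comm] at h
    haveI : NeZero (p ^ 1) := ⟨pow_ne_zero 1 hp.out.ne_zero⟩
    haveI : Fact (1 < p ^ 1) := ⟨lt_of_lt_of_eq hp.out.one_lt (pow_one p).symm⟩
    have hval : x = 1 := ZMod.val_injective (p ^ 1) (by rw [hxval, ZMod.val_one])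
    -- `ker (toZModPow 1) = pℤ_p = ker toZMod`
    have hker : ((GaloisRep.cyclotomicCharacter K p k : ℤ_[p]ˣ) : ℤ_[p]) - 1 ∈ RingHom.ker (PadicInt.toZModPow 1) := by
      rw [RingHom.mem_ker, map_sub, map_one, ← hx, hval, sub_self]
    rw [PadicInt.ker_toZModPow, pow_one, ← PadicInt.maximalIdeal_eq_span_p, ← PadicInt.ker_toZMod,
      RingHom.mem_ker, map_sub, map_one, sub_eq_zero] at hker
    exact hker
  have hχ : GaloisRep.cyclotomicCharacter K p k = 1 := eq_one_of_isOfFinOrder_of_toZMod_eq_one hp2 htor h1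
  have h := GaloisRep.cyclotomicCharacter_spec K p (k := m) k ζ hζ
  rw [hχ, Units.val_one, map_one] at h
  rcases Nat.eq_zero_or_pos m with rfl | hm
  · rw [pow_zero, pow_one] at hζ; rw [hζ, smul_one]
  · haveI : Fact (1 < p ^ m) := ⟨Nat.one_lt_pow hm.ne' hp.out.one_lt⟩
    rwa [ZMod.val_one, pow_one] at h

variable {κ} in
/-- **`Gal(K̄/K₀·K_n^κ)` fixes `μ_{p^{n+1}}(K̄)`** — i.e. `K₀·K_n^κ ⊇ K(ζ_{p^{n+1}})` — for `κ`
cyclotomic, `K₀ ⊇ μ_p` with `[Γ_K : Gal(K̄/K₀)]` prime to `p`, `p` odd: `σ ∈ κ⁻¹(pⁿℤ_p) ∩ Gal(K̄/K₀)`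
is `ρ^{pⁿ}·k` with `ρ ∈ Gal(K̄/K₀)` (`κ(Gal(K̄/K₀)) = ℤ_p`) and `k ∈ ker κ ∩ Gal(K̄/K₀)`.
[cite: Kobayashi2003, §2 p. 4 (K_n = ℚ(ζ_{p^{n+1}}))] [cite: Washington1997, §13.1] -/
theorem smul_eq_self_of_mem_towerSubgroup (hp2 : p ≠ 2) (hκ : κ.IsCyclotomic)
    (hz : ∃ z : K₀, IsPrimitiveRoot z p) (hidx : ¬ p ∣ (galRange (K := K) K₀).index) {n : ℕ}
    {σ : Field.absoluteGaloisGroup K} (hσ : σ ∈ towerSubgroup κ K₀ n)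
    {ζ : AlgebraicClosure K} (hζ : ζ ^ p ^ (n + 1) = 1) : σ • ζ = ζ := by
  rw [mem_towerSubgroup_iff, mem_layerSubgroup] at hσ
  obtain ⟨⟨a, ha⟩, hσ₀⟩ := hσ
  obtain ⟨ρ, hρ₀, hρa⟩ := exists_mem_galRange_apply_eq κ K₀ hidx a
  -- `k = (ρ^{pⁿ})⁻¹ σ ∈ ker κ ∩ Gal(K̄/K₀)`
  set k : Field.absoluteGaloisGroup K := (ρ ^ p ^ n)⁻¹ * σ with hk
  have hkκ : k ∈ κ.kerSubgroup := by
    rw [mem_kerSubgroup, hk, map_mul, map_inv, map_pow, hρa, ← ofAdd_nsmul, nsmul_eq_mul, Nat.cast_pow,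
      ← ha, ofAdd_toAdd, inv_mul_cancel]
  have hk₀ : k ∈ galRange (K := K) K₀ :=
    (galRange (K := K) K₀).mul_mem ((galRange (K := K) K₀).inv_mem ((galRange (K := K) K₀).pow_mem hρ₀ _)) hσ₀
  have hσk : σ = ρ ^ p ^ n * k := by rw [hk, mul_inv_cancel_left]
  -- a primitive `p^{n+1}`-th root `ζ₀`; `ζ` is a power of it
  haveI : NeZero ((p ^ (n + 1) : ℕ) : AlgebraicClosure K) := ⟨by exact_mod_cast pow_ne_zero (n + 1) hp.out.ne_zero⟩
  obtain ⟨ζ₀, hζ₀⟩ := HasEnoughRootsOfUnity.exists_primitiveRoot (AlgebraicClosure K) (p ^ (n + 1))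
  obtain ⟨i, -, rfl⟩ := hζ₀.eq_pow_of_pow_eq_one hζ
  rw [smul_pow', hσk, mul_smul, smul_eq_self_of_mem_kerSubgroup_of_mem_galRange K₀ hp2 hκ hz hkκ hk₀ hζ₀.pow_eq_one,
    pow_smul_eq_self_of_mem_galRange K₀ hz hρ₀ n hζ₀]

end Global

/-! ## §3 LOCAL: `(towerSubgroup κ K₀ n)_{ℚ_p} = Stab(ζ_{p^{n+1}})` -/

section Local

variable {K : Type} [Field K] [NumberField K] [Algebra K ℚ_[p]] (κ : ZpExtension K p)
  (K₀ : Type) [Field K₀] [NumberField K₀] [Algebra K K₀]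
  (ι : AlgebraicClosure K →ₐ[K] AlgebraicClosure ℚ_[p])

variable {κ} in
/-- **`(towerSubgroup κ K₀ n)_{ℚ_p} ≤ Stab(ζ_{p^{n+1}})`**: an element of `Γ_{ℚ_p}` restricting into
`Gal(K̄/K₀·K_n^κ)` fixes `ι(ζ)` for a primitive `p^{n+1}`-th root `ζ ∈ K̄` (§2), hence the primitive
`p^{n+1}`-th root `zeta p (n+1) ∈ ℚ̄_p`. [cite: Kobayashi2003, §2 p. 4 (k_n = ℚ_p(ζ_{p^{n+1}}))] -/
theorem localSubgroupOfEmb_towerSubgroup_le_stab (hp2 : p ≠ 2) (hκ : κ.IsCyclotomic)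
    (hz : ∃ z : K₀, IsPrimitiveRoot z p) (hidx : ¬ p ∣ (galRange (K := K) K₀).index) (n : ℕ) :
    localSubgroupOfEmb (towerSubgroup κ K₀ n) ι ≤ stab p (n + 1) := by
  intro τ hτ
  rw [mem_localSubgroupOfEmb_iff] at hτ
  haveI : NeZero ((p ^ (n + 1) : ℕ) : AlgebraicClosure K) := ⟨by exact_mod_cast pow_ne_zero (n + 1) hp.out.ne_zero⟩
  haveI : NeZero (p ^ (n + 1)) := ⟨pow_ne_zero (n + 1) hp.out.ne_zero⟩
  obtain ⟨ζ, hζ⟩ := HasEnoughRootsOfUnity.exists_primitiveRoot (AlgebraicClosure K) (p ^ (n + 1))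
  have hιζ : IsPrimitiveRoot (ι ζ) (p ^ (n + 1)) := hζ.map_of_injective ι.injective
  rw [mem_stab_iff, smul_eq_self_iff_of_isPrimitiveRoot (isPrimitiveRoot_zeta p (n + 1)) hιζ]
  have hfix : resGalOfEmb ι τ • ζ = ζ := smul_eq_self_of_mem_towerSubgroup K₀ hp2 hκ hz hidx hτ hζ.pow_eq_one
  have h := apply_resGalAuxOfEmb_apply ι τ ζ
  rw [absoluteGaloisGroup.smul_def] at hfix ⊢
  change ι ((show AlgebraicClosure K ≃ₐ[K] AlgebraicClosure K from resGalOfEmb ι τ) ζ) = _ at h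
  rw [show (absoluteGaloisGroup.toAlgEquiv K (resGalOfEmb ι τ)) ζ =
      (show AlgebraicClosure K ≃ₐ[K] AlgebraicClosure K from resGalOfEmb ι τ) ζ from rfl] at hfix
  rw [hfix] at h
  rw [show (absoluteGaloisGroup.toAlgEquiv ℚ_[p] τ) (ι ζ) =
      (show AlgebraicClosure ℚ_[p] ≃ₐ[ℚ_[p]] AlgebraicClosure ℚ_[p] from τ) (ι ζ) from rfl]
  exact h.symm

variable [(galRange (K := K) K₀).Normal]

/-- **The local index bound**: `[Γ_{ℚ_p} : (towerSubgroup κ K₀ n)_{ℚ_p}]` divides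
`[Γ_K : Gal(K̄/K₀·K_n^κ)] ≤ pⁿ · [Γ_K : Gal(K̄/K₀)]`. [cite: SerreGaloisCohomology1997, II.§1.1] -/
theorem index_localSubgroupOfEmb_towerSubgroup_le (n : ℕ) :
    (localSubgroupOfEmb (towerSubgroup κ K₀ n) ι).index ≤ p ^ n * (galRange (K := K) K₀).index ∧
      (localSubgroupOfEmb (towerSubgroup κ K₀ n) ι).index ≠ 0 := by
  have hdvd := index_localSubgroupOfEmb_dvd ι (towerSubgroup κ K₀ n)
  have hne : (towerSubgroup κ K₀ n).index ≠ 0 := Subgroup.FiniteIndex.index_ne_zero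
  refine ⟨(Nat.le_of_dvd (Nat.pos_of_ne_zero hne) hdvd).trans ?_, fun h0 => hne (Nat.eq_zero_of_zero_dvd (h0 ▸ hdvd))⟩
  have h := Subgroup.index_inf_le (H := κ.layerSubgroup n) (K := galRange (K := K) K₀)
  rw [κ.index_layerSubgroup n] at h
  exact h

variable {κ} in
/-- **F9 — `(towerSubgroup κ K₀ n)_{ℚ_p} = Stab(ζ_{p^{n+1}})`, i.e. `K_{n,v} = ℚ_p(ζ_{p^{n+1}})`.** For `κ`
cyclotomic, `K₀ ⊇ μ_p` with `[Γ_K : Gal(K̄/K₀)] ≤ p − 1` (Kobayashi: `K = ℚ`, `K₀ = ℚ(μ_p)`), `p` odd: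
the inclusion of §3 plus the index count `[Γ_{ℚ_p} : (·)_{ℚ_p}] ≤ pⁿ(p − 1) = φ(p^{n+1}) =
[Γ_{ℚ_p} : Stab(ζ_{p^{n+1}})]` force equality. This is the hypothesis `hU` of
`localFixedPointsOfEmb_le_sup_towerSigned` (file KobayashiSignedGenerationDischarge) for cc-typer-6's
tower `towerSubgroup κ K₀`. [cite: Kobayashi2003, §2 p. 4 (k_n = ℚ_p(ζ_{p^{n+1}}), K_n/ℚ totally ramified at p)]
[cite: SerreLocalFields1979, Ch. IV §4] -/
theorem localSubgroupOfEmb_towerSubgroup_eq_stab (hp2 : p ≠ 2) (hκ : κ.IsCyclotomic)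
    (hz : ∃ z : K₀, IsPrimitiveRoot z p) (hidx : (galRange (K := K) K₀).index ≤ p - 1) (n : ℕ) :
    localSubgroupOfEmb (towerSubgroup κ K₀ n) ι = stab p (n + 1) := by
  have hidx0 : (galRange (K := K) K₀).index ≠ 0 := Subgroup.FiniteIndex.index_ne_zero
  have hndvd : ¬ p ∣ (galRange (K := K) K₀).index := fun h =>
    absurd (Nat.le_of_dvd (Nat.pos_of_ne_zero hidx0) h) (by have := hp.out.one_lt; omega)
  have hle := localSubgroupOfEmb_towerSubgroup_le_stab K₀ ι hp2 hκ hz hndvd n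
  obtain ⟨hbound, hne⟩ := index_localSubgroupOfEmb_towerSubgroup_le κ K₀ ι n
  set A := localSubgroupOfEmb (towerSubgroup κ K₀ n) ι with hA
  have hB : (stab p (n + 1)).index = p ^ n * (p - 1) := by
    rw [index_stab', Nat.totient_prime_pow_succ hp.out]
  -- `B.index ∣ A.index ≤ B.index`
  have hdvd : (stab p (n + 1)).index ∣ A.index := Subgroup.index_dvd_of_le hle
  have hAB : A.index ≤ (stab p (n + 1)).index := by
    rw [hB]; exact hbound.trans (Nat.mul_le_mul_left _ hidx)
  have heq : A.index = (stab p (n + 1)).index :=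
    le_antisymm hAB (Nat.le_of_dvd (Nat.pos_of_ne_zero hne) hdvd)
  have hB0 : (stab p (n + 1)).index ≠ 0 := by rw [← heq]; exact hne
  have hrel : A.relIndex (stab p (n + 1)) = 1 := by
    have h := Subgroup.relIndex_mul_index hle
    rw [heq] at h
    exact (mul_eq_right₀ hB0).mp h
  exact le_antisymm hle (Subgroup.relIndex_eq_one.mp hrel)

end Local

end Literature.NumberTheory.EllipticCurves.Sprung2012.Honda

end Part8

/-!
## Part 9 — port of `Summits/BirchSwinnertonDyer/Rank1Residual/Additive/KobayashiSignedGenerationRat.lean` (1 declarations kept)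

# Kobayashi's own setting, NO hypothesis left: `K = ℚ`, `K₀ = ℚ(ζ_p)`, `κ` the cyclotomic
# `ℤ_p`-extension — `K_{n,v} = ℚ_p(ζ_{p^{n+1}})` and `E(k_n) = E⁺(k_n) + E⁻(k_n)` (Prop. 8.12 ii))
# for every globally minimal `E/ℚ` with good supersingular reduction, `a_p = 0`, `p` odd
#

(Port of the declarations listed in the Part header; the source module's docstring — cell bookkeeping of the BSD
printed-inputs programme — is abridged to its title here.)
-/

section Part9

open scoped _root_.Classical

namespace Literature.NumberTheory.EllipticCurves.Sprung2012.Honda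

open Literature.NumberTheory.EllipticCurves Literature.NumberTheory.GaloisRepresentations
  Literature.NumberTheory.EllipticCurves.Kobayashi2003 Literature.NumberTheory.EllipticCurves.CyclotomicZp ZpExtension
  _root_.WeierstrassCurve PadicCyclotomicTower

variable (p : ℕ) [hp : Fact p.Prime] (F : Type) [Field F] [NumberField F] [hF : IsCyclotomicExtension {p} ℚ F]
  (ι : AlgebraicClosure ℚ →ₐ[ℚ] AlgebraicClosure ℚ_[p])

variable {p} in
/-- **Kobayashi's `k_n = ℚ_p(ζ_{p^{n+1}})`, kernel form**: for `κ : ZpExtension ℚ p` cyclotomic,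
`F = ℚ(ζ_p)`, `p` odd and any `ι : ℚ̄ → ℚ̄_p`, the local subgroup of `Gal(ℚ̄/F·ℚ_n^κ)` at `ι` is the
stabiliser of `ζ_{p^{n+1}}` in `Gal(ℚ̄_p/ℚ_p)`. [cite: Kobayashi2003, §2 p. 4 (k_n = ℚ_p(ζ_{p^{n+1}}))] -/
theorem localSubgroupOfEmb_towerSubgroup_eq_stab_rat (κ : ZpExtension ℚ p) (hp2 : p ≠ 2)
    (hκ : κ.IsCyclotomic) (n : ℕ) : localSubgroupOfEmb (towerSubgroup κ F n) ι = stab p (n + 1) := by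
  haveI := normal_galRange_cyclotomic p F
  exact localSubgroupOfEmb_towerSubgroup_eq_stab F ι hp2 hκ ⟨_, IsCyclotomicExtension.zeta_spec p ℚ F⟩
    (by rw [index_galRange_cyclotomic p F]) n

end Literature.NumberTheory.EllipticCurves.Sprung2012.Honda

end Part9

/-!
## Part 10 — port of `Summits/BirchSwinnertonDyer/BirchSwinnertonDyer/Theorems/PrintX8VSInputHondaSystemLayerGalois.lean` (9 declarations kept)

# The `ℤ_p`-layer subgroups `H_n = Gal(ℚ̄_p/ℚ_{p,n})` inside the cyclotomic tower `k_n = ℚ_p(ζ_{p^{n+1}})`: `Stab(ζ_{p^{n+1}}) ≤ H_n`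
# with index `p − 1`, `H_n` acts on `ζ_{p^{n+1}}` through `μ_{p−1}`, and every element of `μ_{p−1}` occurs
#

(Port of the declarations listed in the Part header; the source module's docstring — cell bookkeeping of the BSD
printed-inputs programme — is abridged to its title here.)
-/

section Part10

open scoped _root_.Classical

namespace Literature.NumberTheory.EllipticCurves.Sprung2012.Honda

namespace SprungHonda

open Literature.NumberTheory.EllipticCurves Literature.NumberTheory.GaloisRepresentations
  Literature.NumberTheory.EllipticCurves.Kobayashi2003 Literature.NumberTheory.EllipticCurves.ZpExtension
  Literature.NumberTheory.EllipticCurves.Sprung2012.Honda Literature.NumberTheory.EllipticCurves.Sprung2012.Honda.PadicCyclotomicTower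

variable {p : ℕ} [hp : Fact p.Prime] {κ : ZpExtension ℚ p} (ι : AlgebraicClosure ℚ →ₐ[ℚ] AlgebraicClosure ℚ_[p])

/-! ## §1 `Stab(ζ_{n+1}) ≤ H_n`, the `(p−1)`-st power, and the action on `ζ_{n+1}` -/

/-- **`Stab(ζ_{n+1}) ≤ H_n`**: `Gal(ℚ̄_p/ℚ_p(ζ_{p^{n+1}})) = Gal(ℚ̄_p/(F·ℚ_n)_v) ≤ Gal(ℚ̄_p/ℚ_{n,v})`.
[cite: Sprung2012, §2 p. 1486] -/
theorem stab_succ_le_localLayerSubgroup (hp2 : p ≠ 2) (hκ : κ.IsCyclotomic) (n : ℕ) :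
    stab p (n + 1) ≤ localSubgroupOfEmb (κ.layerSubgroup n) ι := by
  haveI : NeZero p := ⟨hp.out.ne_zero⟩
  haveI := Literature.NumberTheory.NumberFields.isCyclotomicExtension_cyclotomicField_rat p
  rw [← localSubgroupOfEmb_towerSubgroup_eq_stab_rat (F := CyclotomicField p ℚ) (ι := ι) κ hp2 hκ n]
  exact Subgroup.comap_mono inf_le_left

/-- **`τ ∈ H_n ⇒ τ^{p−1} ∈ Stab(ζ_{n+1})`**: `Γ_ℚ / Gal(ℚ̄/F)` has order `[F : ℚ] = p − 1`, so `(res τ)^{p−1} ∈ Gal(ℚ̄/F) ∩ κ⁻¹(pⁿℤ_p)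
= Gal(ℚ̄/F·ℚ_n)`, whose local subgroup is `Stab(ζ_{n+1})`. [cite: Sprung2012, §2 p. 1486 (G_n = Δ × Γ_n)] -/
theorem pow_sub_one_mem_stab (hp2 : p ≠ 2) (hκ : κ.IsCyclotomic) {n : ℕ} {τ : Field.absoluteGaloisGroup ℚ_[p]}
    (hτ : τ ∈ localSubgroupOfEmb (κ.layerSubgroup n) ι) : τ ^ (p - 1) ∈ stab p (n + 1) := by
  haveI : NeZero p := ⟨hp.out.ne_zero⟩
  haveI := Literature.NumberTheory.NumberFields.isCyclotomicExtension_cyclotomicField_rat p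
  haveI := normal_galRange_cyclotomic p (CyclotomicField p ℚ)
  rw [← localSubgroupOfEmb_towerSubgroup_eq_stab_rat (F := CyclotomicField p ℚ) (ι := ι) κ hp2 hκ n,
    mem_localSubgroupOfEmb_iff, map_pow, mem_towerSubgroup_iff]
  rw [mem_localSubgroupOfEmb_iff] at hτ
  refine ⟨Subgroup.pow_mem _ hτ _, ?_⟩
  rw [← index_galRange_cyclotomic p (CyclotomicField p ℚ)]
  exact Subgroup.pow_index_mem _ _

/-- Iterating an automorphism that raises `ζ` to the `c`-th power: `τᵏ • ζ = ζ^{cᵏ}`. [cite: Sprung2012, §2 p. 1486] -/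
theorem pow_smul_eq_pow_pow {ζ : PadicAlgCl p} {τ : Field.absoluteGaloisGroup ℚ_[p]} {c : ℕ} (h : τ • ζ = ζ ^ c) (k : ℕ) :
    τ ^ k • ζ = ζ ^ c ^ k := by
  induction k with
  | zero => rw [pow_zero, one_smul, pow_zero, pow_one]
  | succ k ih => rw [pow_succ, mul_smul, h, smul_pow', ih, ← pow_mul, ← pow_succ]

/-- **The action of `H_n` on `ζ_{n+1}` factors through `μ_{p−1}`**: for `τ ∈ H_n` there is `c < p^{n+1}` with `τ • ζ_{n+1} = ζ_{n+1}ᶜ`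
and `c^{p−1} ≡ 1 (mod p^{n+1})`. [cite: Sprung2012, §2 p. 1486] -/
theorem exists_smul_zeta_eq_pow_of_mem_localLayerSubgroup (hp2 : p ≠ 2) (hκ : κ.IsCyclotomic) {n : ℕ}
    {τ : Field.absoluteGaloisGroup ℚ_[p]} (hτ : τ ∈ localSubgroupOfEmb (κ.layerSubgroup n) ι) :
    ∃ c : ℕ, c < p ^ (n + 1) ∧ τ • zeta p (n + 1) = zeta p (n + 1) ^ c ∧ c ^ (p - 1) ≡ 1 [MOD p ^ (n + 1)] := by
  obtain ⟨c, hc, hcζ⟩ := exists_apply_zeta_eq_pow p (Field.absoluteGaloisGroup.toAlgEquiv ℚ_[p] τ) (n + 1)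
  have hsmul : τ • zeta p (n + 1) = zeta p (n + 1) ^ c := hcζ
  refine ⟨c, hc, hsmul, ?_⟩
  have hfix : τ ^ (p - 1) • zeta p (n + 1) = zeta p (n + 1) := (mem_stab_iff _).mp (pow_sub_one_mem_stab ι hp2 hκ hτ)
  rw [pow_smul_eq_pow_pow hsmul] at hfix
  exact (pow_eq_pow_iff_modEq_of_isPrimitiveRoot (isPrimitiveRoot_zeta p (n + 1))
    (pow_ne_zero _ hp.out.ne_zero)).mp (hfix.trans (pow_one _).symm)

/-- An exponent `c ≡ 1 (mod pⁿ)`, `n ≥ 1`, with `c^{p−1} ≡ 1 (mod p^{n+1})` is `≡ 1 (mod p^{n+1})`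
(`c = 1 + pⁿt` gives `c^{p−1} ≡ 1 + (p−1)pⁿt (mod p^{2n})`, so `p ∣ (p−1)t`, `p ∣ t`). [cite: Sprung2012, §2 p. 1486] -/
theorem modEq_one_of_pow_sub_one_modEq_one {n c : ℕ} (hn : 1 ≤ n) (h1 : c ≡ 1 [MOD p ^ n])
    (h2 : c ^ (p - 1) ≡ 1 [MOD p ^ (n + 1)]) : c ≡ 1 [MOD p ^ (n + 1)] := by
  have hpz : Prime (p : ℤ) := Nat.prime_iff_prime_int.mp hp.out
  -- translate to divisibilities in `ℤ`
  rw [Nat.ModEq.comm, Nat.modEq_iff_dvd] at h1 h2 ⊢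
  push_cast at h1 h2 ⊢
  obtain ⟨t, ht⟩ := h1
  -- `c = 1 + pⁿ t`
  have hc : (c : ℤ) = 1 + (p : ℤ) ^ n * t := by linear_combination ht
  -- second-order binomial congruence
  have hsq : ((p : ℤ) ^ n * t) ^ 2 ∣ (1 + (p : ℤ) ^ n * t) ^ (p - 1) - 1 ^ (p - 1 - 1) * ((p : ℤ) ^ n * t) * ((p - 1 : ℕ) : ℤ) -
      1 ^ (p - 1) := sq_dvd_add_pow_sub_sub _ _ _
  rw [one_pow, one_pow, one_mul] at hsq
  have hpn : (p : ℤ) ^ (n + 1) ∣ ((p : ℤ) ^ n * t) ^ 2 := by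
    rw [mul_pow, ← pow_mul]
    exact (pow_dvd_pow _ (by omega)).mul_right _
  have hA : (p : ℤ) ^ (n + 1) ∣ (c : ℤ) ^ (p - 1) - 1 - (p : ℤ) ^ n * t * ((p - 1 : ℕ) : ℤ) := by
    have := hpn.trans hsq
    rwa [← hc, show (c : ℤ) ^ (p - 1) - (p : ℤ) ^ n * t * ((p - 1 : ℕ) : ℤ) - 1 =
      (c : ℤ) ^ (p - 1) - 1 - (p : ℤ) ^ n * t * ((p - 1 : ℕ) : ℤ) by ring] at this
  have hB : (p : ℤ) ^ (n + 1) ∣ (p : ℤ) ^ n * t * ((p - 1 : ℕ) : ℤ) := by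
    have := dvd_sub h2 hA
    rwa [sub_sub_cancel] at this
  -- cancel `pⁿ`: `p ∣ t (p − 1)`, and `p ∤ p − 1`
  rw [pow_succ, mul_assoc] at hB
  have hpt : (p : ℤ) ∣ t * ((p - 1 : ℕ) : ℤ) := (mul_dvd_mul_iff_left (pow_ne_zero n hpz.ne_zero)).mp hB
  have hndvd : ¬ (p : ℤ) ∣ ((p - 1 : ℕ) : ℤ) := by
    intro h
    have h' : p ∣ p - 1 := by exact_mod_cast h
    have := Nat.le_of_dvd (Nat.sub_pos_of_lt hp.out.one_lt) h'
    have h2 := hp.out.one_lt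
    omega
  have ht' : (p : ℤ) ∣ t := (hpz.dvd_or_dvd hpt).resolve_right hndvd
  obtain ⟨u, rfl⟩ := ht'
  refine ⟨u, ?_⟩
  linear_combination ht

/-- **`H_n ∩ Stab(ζ_n) = Stab(ζ_{n+1})` for `n ≥ 1`**: an element of `H_n` fixing `ζ_n = ζ_{n+1}ᵖ` fixes `ζ_{n+1}` (its exponent
`c` has `c ≡ 1 (mod pⁿ)` and `c^{p−1} ≡ 1 (mod p^{n+1})`). Consequently `H_n/Stab(ζ_{n+1}) → H_{n−1}/Stab(ζ_n)` is injective.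
[cite: Sprung2012, §2 p. 1486] -/
theorem mem_stab_succ_of_mem_localLayerSubgroup_of_mem_stab (hp2 : p ≠ 2) (hκ : κ.IsCyclotomic) {n : ℕ} (hn : 1 ≤ n)
    {τ : Field.absoluteGaloisGroup ℚ_[p]} (hτ : τ ∈ localSubgroupOfEmb (κ.layerSubgroup n) ι) (hτn : τ ∈ stab p n) :
    τ ∈ stab p (n + 1) := by
  obtain ⟨c, -, hcζ, hc1⟩ := exists_smul_zeta_eq_pow_of_mem_localLayerSubgroup ι hp2 hκ hτ
  -- `τ • ζ_n = ζ_nᶜ` (as `ζ_n = ζ_{n+1}ᵖ`), and `τ` fixes `ζ_n`: so `c ≡ 1 (mod pⁿ)`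
  have hzn : zeta p n = zeta p (n + 1) ^ p := (zeta_succ_pow p n).symm
  have hτζn : τ • zeta p n = zeta p n ^ c := by
    rw [hzn, smul_pow', hcζ, ← pow_mul, ← pow_mul, mul_comm]
  have hfixn : τ • zeta p n = zeta p n := (mem_stab_iff _).mp hτn
  have h1 : c ≡ 1 [MOD p ^ n] := by
    refine (pow_eq_pow_iff_modEq_of_isPrimitiveRoot (isPrimitiveRoot_zeta p n) (pow_ne_zero _ hp.out.ne_zero)).mp ?_
    rw [pow_one, ← hτζn, hfixn]
  have hc : c ≡ 1 [MOD p ^ (n + 1)] := modEq_one_of_pow_sub_one_modEq_one hn h1 hc1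
  rw [mem_stab_iff, hcζ]
  conv_rhs => rw [← pow_one (zeta p (n + 1))]
  exact (pow_eq_pow_iff_modEq_of_isPrimitiveRoot (isPrimitiveRoot_zeta p (n + 1)) (pow_ne_zero _ hp.out.ne_zero)).mpr hc

/-! ## §3 Indices: `[H_n : Stab(ζ_{n+1})] = p − 1`, `[Γ : H_n] = pⁿ`, `[H_n : H_{n+1}] = p`; the `Δ`-bijection -/

/-- **`[H_n : Stab(ζ_{n+1})] = p − 1` and `[Γ : H_n] = pⁿ`**: `[Γ : Stab(ζ_{n+1})] = φ(p^{n+1}) = pⁿ(p−1)`, `[Γ : H_n] ∣ pⁿ`, and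
`H_n / Stab(ζ_{n+1})` has exponent dividing `p − 1`, so (Cauchy) order prime to `p`. [cite: Sprung2012, §2 p. 1486]
[cite: Washington1997, §13.1] -/
theorem index_quotientStab_and_index_localLayerSubgroup (hp2 : p ≠ 2) (hκ : κ.IsCyclotomic) (n : ℕ) :
    ((stab p (n + 1)).subgroupOf (localSubgroupOfEmb (κ.layerSubgroup n) ι)).index = p - 1 ∧
      (localSubgroupOfEmb (κ.layerSubgroup n) ι).index = p ^ n := by
  set H := localSubgroupOfEmb (κ.layerSubgroup n) ι with hH
  haveI : (stab p (n + 1)).Normal := normal_stab (n + 1)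
  have hle : stab p (n + 1) ≤ H := stab_succ_le_localLayerSubgroup ι hp2 hκ n
  have hp1 : p - 1 ≠ 0 := by have := hp.out.one_lt; omega
  have hmul : ((stab p (n + 1)).subgroupOf H).index * H.index = (p - 1) * p ^ n := by
    rw [← Subgroup.relIndex, Subgroup.relIndex_mul_index hle, index_stab' p (n + 1),
      Nat.totient_prime_pow hp.out (Nat.succ_pos n), Nat.succ_sub_one, mul_comm]
  -- in `H_n / Stab(ζ_{n+1})` every element is killed by `p − 1`
  have hexp : ∀ q : H ⧸ (stab p (n + 1)).subgroupOf H, q ^ (p - 1) = 1 := by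
    intro q
    induction q using QuotientGroup.induction_on with
    | H τ =>
      rw [← QuotientGroup.mk_pow, QuotientGroup.eq_one_iff, Subgroup.mem_subgroupOf, Subgroup.coe_pow]
      exact pow_sub_one_mem_stab ι hp2 hκ τ.2
  have hdvd : H.index ∣ p ^ n := index_localLayerSubgroupOfEmb_dvd κ ι n
  obtain ⟨j, hj, hHj⟩ := (Nat.dvd_prime_pow hp.out).1 hdvd
  -- `p ∤ [H_n : Stab(ζ_{n+1})]`
  have hndvd : ¬ p ∣ ((stab p (n + 1)).subgroupOf H).index := by
    intro hd
    haveI : ((stab p (n + 1)).subgroupOf H).FiniteIndex := ⟨fun h0 ↦ by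
      rw [h0, zero_mul] at hmul
      exact (mul_ne_zero hp1 (pow_ne_zero n hp.out.ne_zero)) hmul.symm⟩
    haveI : Finite (H ⧸ (stab p (n + 1)).subgroupOf H) := Subgroup.finite_quotient_of_finiteIndex
    obtain ⟨x, hx⟩ := exists_prime_orderOf_dvd_card' (G := H ⧸ (stab p (n + 1)).subgroupOf H) p hd
    have h1 : orderOf x ∣ p - 1 := orderOf_dvd_of_pow_eq_one (hexp x)
    rw [hx] at h1
    have := Nat.le_of_dvd (by omega) h1
    omega
  have hcop : (p ^ n).Coprime ((stab p (n + 1)).subgroupOf H).index :=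
    Nat.Coprime.pow_left n ((Nat.Prime.coprime_iff_not_dvd hp.out).2 hndvd)
  -- so `j = n`
  have hjn : j = n := by
    have h1 : p ^ n ∣ ((stab p (n + 1)).subgroupOf H).index * p ^ j := by
      rw [← hHj, hmul]; exact dvd_mul_left _ _
    have h2 : p ^ n ∣ p ^ j := hcop.dvd_of_dvd_mul_left h1
    have := (Nat.pow_dvd_pow_iff_le_right hp.out.one_lt).1 h2
    omega
  subst hjn
  refine ⟨?_, hHj⟩
  rw [hHj] at hmul
  exact Nat.eq_of_mul_eq_mul_right (pow_pos hp.out.pos j) hmul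

/-- **`[H_n : H_{n+1}] = p`** (`[Γ : H_n] = pⁿ`). [cite: Sprung2012, §2 p. 1486] [cite: Washington1997, §13.1] -/
theorem index_localLayerSubgroup_succ_subgroupOf (hp2 : p ≠ 2) (hκ : κ.IsCyclotomic) (n : ℕ) :
    ((localSubgroupOfEmb (κ.layerSubgroup (n + 1)) ι).subgroupOf (localSubgroupOfEmb (κ.layerSubgroup n) ι)).index = p := by
  have hle : localSubgroupOfEmb (κ.layerSubgroup (n + 1)) ι ≤ localSubgroupOfEmb (κ.layerSubgroup n) ι :=
    localLayerSubgroupOfEmb_antitone κ ι (Nat.le_succ n)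
  have h := Subgroup.relIndex_mul_index hle
  rw [Subgroup.relIndex, (index_quotientStab_and_index_localLayerSubgroup ι hp2 hκ n).2,
    (index_quotientStab_and_index_localLayerSubgroup ι hp2 hκ (n + 1)).2, pow_succ'] at h
  exact Nat.eq_of_mul_eq_mul_right (pow_pos hp.out.pos n) h

/-- **The `Δ`-bijection `H_{n+1}/Stab(ζ_{n+2}) ≃ H_n/Stab(ζ_{n+1})`** induced by the inclusion `H_{n+1} ≤ H_n` (injective by
`H_{n+1} ∩ Stab(ζ_{n+1}) = Stab(ζ_{n+2})`, §2; bijective as both sides have `p − 1` elements): restriction identifies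
`Gal(k_{n+1}/ℚ_{p,n+1})` with `Gal(k_n/ℚ_{p,n})` (`= Δ`). Stated for any subgroups `S₁ = Stab(ζ_{n+1})`, `S₂ = Stab(ζ_{n+2})`
(so that it applies verbatim to the local subgroups of Kobayashi's tower). [cite: Sprung2012, §2 p. 1486 (G_{n} = Δ × Γ_n)] -/
theorem bijective_quotientStab_map (hp2 : p ≠ 2) (hκ : κ.IsCyclotomic) (n : ℕ)
    {S₁ S₂ : Subgroup (Field.absoluteGaloisGroup ℚ_[p])} (hS₁ : S₁ = stab p (n + 1)) (hS₂ : S₂ = stab p (n + 2)) :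
    Function.Bijective fun q : localSubgroupOfEmb (κ.layerSubgroup (n + 1)) ι ⧸
        S₂.subgroupOf (localSubgroupOfEmb (κ.layerSubgroup (n + 1)) ι) ↦
      (QuotientGroup.mk (s := S₁.subgroupOf (localSubgroupOfEmb (κ.layerSubgroup n) ι))
        ⟨((q.out : localSubgroupOfEmb (κ.layerSubgroup (n + 1)) ι) : Field.absoluteGaloisGroup ℚ_[p]),
          localLayerSubgroupOfEmb_antitone κ ι (Nat.le_succ n) q.out.2⟩ :
        localSubgroupOfEmb (κ.layerSubgroup n) ι ⧸ S₁.subgroupOf (localSubgroupOfEmb (κ.layerSubgroup n) ι)) := by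
  subst hS₁ hS₂
  set H₁ := localSubgroupOfEmb (κ.layerSubgroup (n + 1)) ι with hH₁
  set H₀ := localSubgroupOfEmb (κ.layerSubgroup n) ι with hH₀
  have hinj : Function.Injective fun q : H₁ ⧸ (stab p (n + 2)).subgroupOf H₁ ↦
      (QuotientGroup.mk (s := (stab p (n + 1)).subgroupOf H₀)
        ⟨((q.out : H₁) : Field.absoluteGaloisGroup ℚ_[p]), localLayerSubgroupOfEmb_antitone κ ι (Nat.le_succ n) q.out.2⟩ :
        H₀ ⧸ (stab p (n + 1)).subgroupOf H₀) := by
    intro q q' h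
    have h' := h
    rw [QuotientGroup.eq, Subgroup.mem_subgroupOf, Subgroup.coe_mul, Subgroup.coe_inv] at h'
    have hmem : ((q.out : H₁) : Field.absoluteGaloisGroup ℚ_[p])⁻¹ * ((q'.out : H₁) : Field.absoluteGaloisGroup ℚ_[p]) ∈ H₁ :=
      H₁.mul_mem (H₁.inv_mem q.out.2) q'.out.2
    have hst : ((q.out : H₁) : Field.absoluteGaloisGroup ℚ_[p])⁻¹ * ((q'.out : H₁) : Field.absoluteGaloisGroup ℚ_[p]) ∈
        stab p (n + 2) := mem_stab_succ_of_mem_localLayerSubgroup_of_mem_stab ι hp2 hκ (Nat.succ_pos n) hmem h'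
    rw [← QuotientGroup.out_eq' q, ← QuotientGroup.out_eq' q', QuotientGroup.eq, Subgroup.mem_subgroupOf, Subgroup.coe_mul,
      Subgroup.coe_inv]
    exact hst
  haveI : ((stab p (n + 1)).subgroupOf H₀).FiniteIndex := ⟨by
    rw [(index_quotientStab_and_index_localLayerSubgroup ι hp2 hκ n).1]; have := hp.out.one_lt; omega⟩
  haveI : Finite (H₀ ⧸ (stab p (n + 1)).subgroupOf H₀) := Subgroup.finite_quotient_of_finiteIndex
  refine hinj.bijective_of_nat_card_le (le_of_eq ?_)
  rw [← Subgroup.index, ← Subgroup.index, (index_quotientStab_and_index_localLayerSubgroup ι hp2 hκ n).1,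
    (index_quotientStab_and_index_localLayerSubgroup ι hp2 hκ (n + 1)).1]

end SprungHonda

end Literature.NumberTheory.EllipticCurves.Sprung2012.Honda

end Part10

/-!
## Part 11 — port of `Summits/BirchSwinnertonDyer/BirchSwinnertonDyer/Theorems/PrintX8VSInputHondaSystemLocalTraces.lean` (9 declarations kept)

# Traces between the `ℤ_p`-layers `ℚ_{p,n}` and Kobayashi's tower `k_n = ℚ_p(ζ_{p^{n+1}})` on local points

(Port of the declarations listed in the Part header; the source module's docstring — cell bookkeeping of the BSD
printed-inputs programme — is abridged to its title here.)
-/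

section Part11

open scoped _root_.Classical
open _root_.Finset

namespace Literature.NumberTheory.EllipticCurves.Sprung2012.Honda

namespace SprungHonda

open Literature.NumberTheory.EllipticCurves Literature.NumberTheory.GaloisRepresentations
  Literature.NumberTheory.EllipticCurves.ZpExtension Literature.NumberTheory.EllipticCurves.Kobayashi2003
  Literature.NumberTheory.EllipticCurves.Sprung2012.Honda Literature.NumberTheory.EllipticCurves.Sprung2012.Honda.PadicCyclotomicTower
  Literature.NumberTheory.EllipticCurves.Sprung2012.Honda.BallEval

variable {p : ℕ} [hp : Fact p.Prime]

/-! ## §1 The `Δ`-trace through `toLoc` -/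

section ToLoc

variable {K : Type} [Field K] [Algebra K ℚ_[p]] (ι : AlgebraicClosure K →ₐ[K] AlgebraicClosure ℚ_[p]) (W : WeierstrassCurve K)
  {M : WeierstrassCurve ℤ_[p]}

/-- **The trace for a pair `H₁ ⊇ H₂` with local subgroups `Stab(ζ_{m₁}) ⊇ Stab(ζ_{m₂})`, through `toLoc`**: on a point with
coordinates in `ℚ_p(ζ_{m₂})`, `Tr_{H₁/H₂} (toLoc Q) = toLoc (∑_{q ∈ Stab(ζ_{m₁})/Stab(ζ_{m₂})} q̃ ⋆ Q)` with the transported action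
`σ ⋆ Q = toLoc⁻¹ (σ • toLoc Q)` (re-indexing the coset sum, tree `localPairTraceOfEmb_eq_sum_of_bijective`).
[cite: Kobayashi2003, §2 p. 4 (the trace maps)] -/
theorem localPairTraceOfEmb_toLoc_eq_sum (hV : genFibΩ p M = W.baseChange (AlgebraicClosure ℚ_[p]))
    {H₁ H₂ : Subgroup (Field.absoluteGaloisGroup K)} [H₂.FiniteIndex] {m₁ m₂ : ℕ}
    (h₁ : localSubgroupOfEmb H₁ ι = stab p m₁) (h₂ : localSubgroupOfEmb H₂ ι = stab p m₂)
    [Fintype (stab p m₁ ⧸ (stab p m₂).subgroupOf (stab p m₁))] {Q : (genFibΩ p M).toAffine.Point}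
    (hQ : Q ∈ subfieldPoints (genFibΩ p M) (layer p m₂).toSubfield coeffs_mem_layer) :
    localPairTraceOfEmb ι W H₁ H₂ (toLoc hV Q) =
      toLoc hV (∑ q : stab p m₁ ⧸ (stab p m₂).subgroupOf (stab p m₁),
        (toLoc hV).symm (((q.out : stab p m₁) : Field.absoluteGaloisGroup ℚ_[p]) • toLoc hV Q)) := by
  set e := toLoc hV with he
  have hQ' : (e Q : localPoints W ℚ_[p]) ∈ localFixedPointsOfEmb ι W H₂ := by
    rw [mem_localFixedPointsOfEmb_iff]
    intro τ hτ
    rw [h₂] at hτ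
    exact (forall_smul_eq_iff_mem_subfieldPoints hV m₂ (e Q)).mpr (by simpa [he] using hQ) τ hτ
  have hmem : ∀ τ : Field.absoluteGaloisGroup ℚ_[p], τ ∈ stab p m₁ → τ ∈ localSubgroupOfEmb H₁ ι := fun τ hτ ↦ by
    rw [h₁]; exact hτ
  have hmem' : ∀ τ : Field.absoluteGaloisGroup ℚ_[p], τ ∈ localSubgroupOfEmb H₂ ι ↔ τ ∈ stab p m₂ := fun τ ↦ by rw [h₂]
  let g : (stab p m₁ ⧸ (stab p m₂).subgroupOf (stab p m₁)) → localSubgroupOfEmb H₁ ι :=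
    fun q ↦ ⟨((q.out : stab p m₁) : Field.absoluteGaloisGroup ℚ_[p]), hmem _ q.out.2⟩
  have hg : Function.Bijective fun q ↦ (QuotientGroup.mk (g q) :
      localSubgroupOfEmb H₁ ι ⧸ (localSubgroupOfEmb H₂ ι).subgroupOf (localSubgroupOfEmb H₁ ι)) := by
    constructor
    · intro q₁ q₂ hq
      have hq' := QuotientGroup.eq.mp hq
      rw [Subgroup.mem_subgroupOf, Subgroup.coe_mul, Subgroup.coe_inv, hmem'] at hq'
      rw [← QuotientGroup.out_eq' q₁, ← QuotientGroup.out_eq' q₂, QuotientGroup.eq, Subgroup.mem_subgroupOf, Subgroup.coe_mul,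
        Subgroup.coe_inv]
      exact hq'
    · intro r
      obtain ⟨τ, rfl⟩ := QuotientGroup.mk_surjective r
      have hiff : ∀ σ : Field.absoluteGaloisGroup ℚ_[p], σ ∈ localSubgroupOfEmb H₁ ι ↔ σ ∈ stab p m₁ := fun σ ↦ by rw [h₁]
      have hτ : (τ : Field.absoluteGaloisGroup ℚ_[p]) ∈ stab p m₁ := (hiff _).mp τ.2
      refine ⟨QuotientGroup.mk ⟨τ, hτ⟩, ?_⟩
      change QuotientGroup.mk (g (QuotientGroup.mk ⟨(τ : Field.absoluteGaloisGroup ℚ_[p]), hτ⟩)) = QuotientGroup.mk τ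
      rw [QuotientGroup.eq, Subgroup.mem_subgroupOf, Subgroup.coe_mul, Subgroup.coe_inv, hmem']
      obtain ⟨h, hh⟩ := QuotientGroup.mk_out_eq_mul (s := (stab p m₂).subgroupOf (stab p m₁))
        (⟨(τ : Field.absoluteGaloisGroup ℚ_[p]), hτ⟩ : stab p m₁)
      have hh' := congrArg (fun z : stab p m₁ ↦ (z : Field.absoluteGaloisGroup ℚ_[p])) hh
      simp only [Subgroup.coe_mul] at hh'
      change ((((QuotientGroup.mk (s := (stab p m₂).subgroupOf (stab p m₁))
          ⟨(τ : Field.absoluteGaloisGroup ℚ_[p]), hτ⟩).out : stab p m₁) : Field.absoluteGaloisGroup ℚ_[p]))⁻¹ *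
          τ ∈ stab p m₂
      rw [hh', mul_inv_rev, mul_assoc, inv_mul_cancel, mul_one]
      exact (stab p m₂).inv_mem (Subgroup.mem_subgroupOf.mp h.2)
  rw [localPairTraceOfEmb_eq_sum_of_bijective ι W H₁ H₂ hQ' g hg, map_sum]
  exact sum_congr rfl fun q _ ↦ by rw [he, AddEquiv.apply_symm_apply]

end ToLoc

/-! ## §2 The `Δ`-trace on the `ℤ_p`-layers -/

section Layers

variable (κ : ZpExtension ℚ p) (ι : AlgebraicClosure ℚ →ₐ[ℚ] AlgebraicClosure ℚ_[p]) (W : WeierstrassCurve ℚ)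
  (U : ℕ → Subgroup (Field.absoluteGaloisGroup ℚ))

/-- **`𝒟_n X = (p−1)•X` on `E(ℚ_{p,n})`** (`[k_n : ℚ_{p,n}] = p − 1`, file `…LayerGalois`). [cite: Sprung2012, §2 p. 1486] -/
theorem localPairTraceOfEmb_of_mem_layer [∀ n, (U n).FiniteIndex] (hp2 : p ≠ 2) (hκ : κ.IsCyclotomic)
    (hU : ∀ n, localSubgroupOfEmb (U n) ι = stab p (n + 1)) {n : ℕ} {X : localPoints W ℚ_[p]}
    (hX : X ∈ localLayerPointsOfEmb κ ι W n) :
    localPairTraceOfEmb ι W (κ.layerSubgroup n) (U n) X = (p - 1) • X := by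
  rw [localPairTraceOfEmb_apply_of_mem_lower ι W (H₂ := U n) (show X ∈ localFixedPointsOfEmb ι W (κ.layerSubgroup n) from hX),
    hU n, (index_quotientStab_and_index_localLayerSubgroup ι hp2 hκ n).1]

/-- **`Tr_{n+1/n} X = p•X` on `E(ℚ_{p,n})`** (`[ℚ_{p,n+1} : ℚ_{p,n}] = p`, file `…LayerGalois`). [cite: Sprung2012, §2 p. 1486] -/
theorem localTraceOfEmb_of_mem_layer (hp2 : p ≠ 2) (hκ : κ.IsCyclotomic) {n : ℕ} {X : localPoints W ℚ_[p]}
    (hX : X ∈ localLayerPointsOfEmb κ ι W n) : localTraceOfEmb κ ι W n (n + 1) X = p • X := by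
  rw [localTraceOfEmb_apply_of_mem_lower κ ι W n (n + 1) hX, localLayerSubgroupOfEmb, localLayerSubgroupOfEmb,
    index_localLayerSubgroup_succ_subgroupOf ι hp2 hκ n]

/-- **The `Δ`-bijection on traces**: `𝒟_{n+1} X = 𝒟_n X` for `X ∈ E(k_n)` (restriction identifies `Gal(k_{n+1}/ℚ_{p,n+1})` with
`Gal(k_n/ℚ_{p,n})`, file `…LayerGalois`). [cite: Sprung2012, §2 p. 1486 (G_n = Δ × Γ_n)] -/
theorem localPairTraceOfEmb_succ_eq [∀ n, (U n).FiniteIndex] (hp2 : p ≠ 2) (hκ : κ.IsCyclotomic)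
    (hU : ∀ n, localSubgroupOfEmb (U n) ι = stab p (n + 1)) {n : ℕ} {X : localPoints W ℚ_[p]}
    (hX : X ∈ localFixedPointsOfEmb ι W (U n)) :
    localPairTraceOfEmb ι W (κ.layerSubgroup (n + 1)) (U (n + 1)) X = localPairTraceOfEmb ι W (κ.layerSubgroup n) (U n) X := by
  haveI : Fintype (localSubgroupOfEmb (κ.layerSubgroup (n + 1)) ι ⧸
      (localSubgroupOfEmb (U (n + 1)) ι).subgroupOf (localSubgroupOfEmb (κ.layerSubgroup (n + 1)) ι)) := Fintype.ofFinite _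
  let g : (localSubgroupOfEmb (κ.layerSubgroup (n + 1)) ι ⧸
      (localSubgroupOfEmb (U (n + 1)) ι).subgroupOf (localSubgroupOfEmb (κ.layerSubgroup (n + 1)) ι)) →
      localSubgroupOfEmb (κ.layerSubgroup n) ι := fun q ↦
    ⟨((q.out : localSubgroupOfEmb (κ.layerSubgroup (n + 1)) ι) : Field.absoluteGaloisGroup ℚ_[p]),
      localLayerSubgroupOfEmb_antitone κ ι (Nat.le_succ n) q.out.2⟩
  have hg := bijective_quotientStab_map ι hp2 hκ n (hU n) (hU (n + 1))
  rw [localPairTraceOfEmb_eq_sum_of_bijective ι W (κ.layerSubgroup n) (U n) hX g hg, localPairTraceOfEmb_apply]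

/-- **`Tr_{n+1/n} ∘ 𝒟_{n+1} = 𝒟_n ∘ Tr_{k_{n+1}/k_n}` on `E(k_{n+1})`** (both are `Tr_{k_{n+1}/ℚ_{p,n}}`, transitivity of traces).
[cite: Kobayashi2003, §2 p. 4 (the trace maps)] -/
theorem localTraceOfEmb_localPairTraceOfEmb [∀ n, (U n).FiniteIndex] (hUa : Antitone U) (hUL : ∀ n, U n ≤ κ.layerSubgroup n) {n : ℕ}
    {X : localPoints W ℚ_[p]} (hX : X ∈ localFixedPointsOfEmb ι W (U (n + 1))) :
    localTraceOfEmb κ ι W n (n + 1) (localPairTraceOfEmb ι W (κ.layerSubgroup (n + 1)) (U (n + 1)) X) =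
      localPairTraceOfEmb ι W (κ.layerSubgroup n) (U n) (localPairTraceOfEmb ι W (U n) (U (n + 1)) X) := by
  rw [localTraceOfEmb_eq_localPairTraceOfEmb,
    ← localPairTraceOfEmb_trans ι W (κ.layerSubgroup_antitone (Nat.le_succ n)) (hUL (n + 1)) hX,
    localPairTraceOfEmb_trans ι W (hUL n) (hUa (Nat.le_succ n)) hX]

/-- `𝒟_n` commutes with `Γ_{ℚ_p}` on `E(k_n)` (normal subgroups). [cite: Kobayashi2003, §2 p. 4] -/
theorem smul_localPairTraceOfEmb_layer [∀ n, (U n).FiniteIndex] [∀ n, (U n).Normal] (n : ℕ) (σ : Field.absoluteGaloisGroup ℚ_[p]) {X : localPoints W ℚ_[p]}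
    (hX : X ∈ localFixedPointsOfEmb ι W (U n)) :
    σ • localPairTraceOfEmb ι W (κ.layerSubgroup n) (U n) X = localPairTraceOfEmb ι W (κ.layerSubgroup n) (U n) (σ • X) :=
  smul_localPairTraceOfEmb_of_normal ι W _ _ σ hX

/-- `𝒟_n` maps `ℤ[Γ·X]` onto `ℤ[Γ·𝒟_n X]` for `X ∈ E(k_n)`. [cite: Kobayashi2003, §2 p. 4] -/
theorem map_localPairTraceOfEmb_closure_orbit [∀ n, (U n).FiniteIndex] [∀ n, (U n).Normal] (n : ℕ) {X : localPoints W ℚ_[p]} (hX : X ∈ localFixedPointsOfEmb ι W (U n)) :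
    (AddSubgroup.closure (Set.range fun σ : Field.absoluteGaloisGroup ℚ_[p] ↦ σ • X)).map
        (localPairTraceOfEmb ι W (κ.layerSubgroup n) (U n)) =
      AddSubgroup.closure (Set.range fun σ : Field.absoluteGaloisGroup ℚ_[p] ↦
        σ • localPairTraceOfEmb ι W (κ.layerSubgroup n) (U n) X) := by
  rw [AddMonoidHom.map_closure, ← Set.range_comp]
  have h : (⇑(localPairTraceOfEmb ι W (κ.layerSubgroup n) (U n)) ∘ fun σ : Field.absoluteGaloisGroup ℚ_[p] ↦ σ • X) =
      fun σ : Field.absoluteGaloisGroup ℚ_[p] ↦ σ • localPairTraceOfEmb ι W (κ.layerSubgroup n) (U n) X :=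
    funext fun σ ↦ (smul_localPairTraceOfEmb_layer κ ι W U n σ hX).symm
  rw [h]

/-- `𝒟_n X ∈ E(ℚ_{p,n})` for `X ∈ E(k_n)`. [cite: Kobayashi2003, §2 p. 4] -/
theorem localPairTraceOfEmb_mem_layer [∀ n, (U n).FiniteIndex] (n : ℕ) {X : localPoints W ℚ_[p]} (hX : X ∈ localFixedPointsOfEmb ι W (U n)) :
    localPairTraceOfEmb ι W (κ.layerSubgroup n) (U n) X ∈ localLayerPointsOfEmb κ ι W n :=
  localPairTraceOfEmb_mem_of_mem ι W hX

/-- `E(ℚ_{p,n}) ≤ E(k_n)` (`U n ≤ L_n`). [cite: Sprung2012, §2 p. 1486 (ℚ_n ⊆ k_n)] -/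
theorem localLayerPointsOfEmb_le_localFixedPointsOfEmb (hUL : ∀ n, U n ≤ κ.layerSubgroup n) (n : ℕ) :
    localLayerPointsOfEmb κ ι W n ≤ localFixedPointsOfEmb ι W (U n) :=
  localFixedPointsOfEmb_antitone ι W (hUL n)

end Layers

end SprungHonda

end Literature.NumberTheory.EllipticCurves.Sprung2012.Honda

end Part11

/-!
## Part 12 — port of `Summits/BirchSwinnertonDyer/BirchSwinnertonDyer/Theorems/PrintX8VSInputHondaSystemLocalRelations.lean` (2 declarations kept)

# The `Δ`-descended Honda points on the `ℤ_p`-layers at `ℚ_p`: levels and the three trace relations of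
# `Sprung2012.IsHondaSystem`

(Port of the declarations listed in the Part header; the source module's docstring — cell bookkeeping of the BSD
printed-inputs programme — is abridged to its title here.)
-/

section Part12

open scoped _root_.Classical

namespace Literature.NumberTheory.EllipticCurves.Sprung2012.Honda

namespace SprungHonda

open Literature.NumberTheory.EllipticCurves Literature.NumberTheory.GaloisRepresentations
  Literature.NumberTheory.EllipticCurves.ZpExtension Literature.NumberTheory.EllipticCurves.Kobayashi2003
  Literature.NumberTheory.EllipticCurves.Sprung2012.Honda Literature.NumberTheory.EllipticCurves.Sprung2012.Honda.PadicCyclotomicTower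

variable {p : ℕ} [hp : Fact p.Prime] (κ : ZpExtension ℚ p) (ι : AlgebraicClosure ℚ →ₐ[ℚ] AlgebraicClosure ℚ_[p])
  (W : WeierstrassCurve ℚ) (U : ℕ → Subgroup (Field.absoluteGaloisGroup ℚ)) [hUf : ∀ n, (U n).FiniteIndex]

/-- **Levels**: `c_n = N₁•𝒟_n(y_{n+1}) + (p−1)•Q ∈ E(ℚ_{p,n})`. [cite: Sprung2012, Thm. 2.2 (p. 1487)] -/
theorem descent_mem_layer {N₁ : ℤ} {y : ℕ → localPoints W ℚ_[p]} {Q : localPoints W ℚ_[p]}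
    (hyU : ∀ m, y (m + 1) ∈ localFixedPointsOfEmb ι W (U m)) (hQ : Q ∈ localLayerPointsOfEmb κ ι W 0) (n : ℕ) :
    N₁ • localPairTraceOfEmb ι W (κ.layerSubgroup n) (U n) (y (n + 1)) + ((p : ℤ) - 1) • Q ∈ localLayerPointsOfEmb κ ι W n := by
  exact add_mem (AddSubgroup.zsmul_mem _ (localPairTraceOfEmb_mem_layer κ ι W U n (hyU n)) _)
    (AddSubgroup.zsmul_mem _ (localLayerPointsOfEmb_mono κ ι W (Nat.zero_le n) hQ) _)

/-- **The three trace relations of `IsHondaSystem` for the rescaled `Δ`-descent.** With `𝒟_n = Tr_{k_n/ℚ_{p,n}}`,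
`c_n = N₁•𝒟_n(y_{n+1}) + (p−1)•Q`, `N₁ = p + 1 − a`: `c_0 = (a−2)•Q`, `Tr_{1/0} c_1 = a•c_0 − (p−1)•Q`, `Tr_{n+1/n} c_{n+1} = a•c_n − c_{n−1}`
(`n ≥ 1`) — from `Tr_{k_m/k_{m−1}} y_{m+1} = a y_m − y_{m−1} − Q`, `Tr_{k_0/ℚ_p} y_1 = −Q`, transitivity `Tr_{n+1/n} ∘ 𝒟_{n+1} = 𝒟_n ∘ Tr_{k_{n+1}/k_n}`,
the `Δ`-bijection `𝒟_n y_n = 𝒟_{n−1} y_n`, and `𝒟_n = p − 1`, `Tr_{n+1/n} = p` on `E(ℚ_{p,n})`.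
[cite: Sprung2012, §2 p. 1486 and Thm. 2.2 (p. 1487)] [cite: Kobayashi2003, Lemma 8.9] -/
theorem descent_relations (hp2 : p ≠ 2) (hκ : κ.IsCyclotomic) (hUa : Antitone U) (hUL : ∀ n, U n ≤ κ.layerSubgroup n)
    (hU : ∀ n, localSubgroupOfEmb (U n) ι = stab p (n + 1)) {a N₁ : ℤ} (hN₁ : N₁ = p + 1 - a)
    {y : ℕ → localPoints W ℚ_[p]} {Q : localPoints W ℚ_[p]} (hy0 : y 0 = 0)
    (hyU : ∀ m, y (m + 1) ∈ localFixedPointsOfEmb ι W (U m)) (hQ : Q ∈ localLayerPointsOfEmb κ ι W 0)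
    (hrel0 : localPairTraceOfEmb ι W (κ.layerSubgroup 0) (U 0) (y 1) = -Q)
    (hrel : ∀ m : ℕ, 1 ≤ m → localPairTraceOfEmb ι W (U (m - 1)) (U m) (y (m + 1)) = a • y m - y (m - 1) - Q)
    (c : ℕ → localPoints W ℚ_[p])
    (hc : ∀ n, c n = N₁ • localPairTraceOfEmb ι W (κ.layerSubgroup n) (U n) (y (n + 1)) + ((p : ℤ) - 1) • Q) :
    c 0 = (a - 2) • Q ∧
    localTraceOfEmb κ ι W 0 1 (c 1) = a • c 0 - ((p : ℤ) - 1) • Q ∧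
    (∀ n : ℕ, 1 ≤ n → localTraceOfEmb κ ι W n (n + 1) (c (n + 1)) = a • c n - c (n - 1)) := by
  subst hN₁
  have hmono := localLayerPointsOfEmb_mono κ ι W
  have hQn : ∀ n, Q ∈ localLayerPointsOfEmb κ ι W n := fun n ↦ hmono (Nat.zero_le n) hQ
  -- `𝒟_n Q = (p−1)•Q`, `Tr_{n+1/n} Q = p•Q` (as `ℤ`-multiples)
  have hp1 : (((p - 1 : ℕ) : ℤ)) = (p : ℤ) - 1 := by have := hp.out.one_lt; omega
  have hDQ : ∀ n, localPairTraceOfEmb ι W (κ.layerSubgroup n) (U n) Q = ((p : ℤ) - 1) • Q := fun n ↦ by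
    rw [localPairTraceOfEmb_of_mem_layer κ ι W U hp2 hκ hU (hQn n), ← natCast_zsmul, hp1]
  have hTQ : ∀ n, localTraceOfEmb κ ι W n (n + 1) Q = (p : ℤ) • Q := fun n ↦ by
    rw [localTraceOfEmb_of_mem_layer κ ι W hp2 hκ (hQn n), natCast_zsmul]
  -- `Tr_{n+1/n}(𝒟_{n+1} y_{n+2}) = a•𝒟_n y_{n+1} − 𝒟_n y_n − (p−1)•Q`
  have hTD : ∀ n, localTraceOfEmb κ ι W n (n + 1) (localPairTraceOfEmb ι W (κ.layerSubgroup (n + 1)) (U (n + 1)) (y (n + 2))) =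
      a • localPairTraceOfEmb ι W (κ.layerSubgroup n) (U n) (y (n + 1)) -
        localPairTraceOfEmb ι W (κ.layerSubgroup n) (U n) (y n) - ((p : ℤ) - 1) • Q := by
    intro n
    rw [localTraceOfEmb_localPairTraceOfEmb κ ι W U hUa hUL (hyU (n + 1)),
      show localPairTraceOfEmb ι W (U n) (U (n + 1)) (y (n + 2)) = a • y (n + 1) - y n - Q by
        simpa using hrel (n + 1) (Nat.succ_pos n), map_sub, map_sub, map_zsmul, hDQ]
  -- `c_0 = (a−2)•Q`
  have hc0 : c 0 = (a - 2) • Q := by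
    rw [hc 0, hrel0, smul_neg, ← neg_smul, ← add_smul]
    congr 1
    ring
  refine ⟨hc0, ?_, ?_⟩
  · -- `Tr_{1/0} c_1 = a•c_0 − (p−1)•Q`
    rw [hc 1, map_add, map_zsmul, map_zsmul, hTD 0, hy0, map_zero, sub_zero, hrel0, hTQ 0, hc0]
    module
  · intro n hn
    obtain ⟨k, rfl⟩ := Nat.exists_eq_add_of_le' hn
    rw [hc (k + 1 + 1), map_add, map_zsmul, map_zsmul, show k + 1 + 2 = k + 1 + 1 + 1 from rfl, hTD (k + 1), hTQ (k + 1),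
      localPairTraceOfEmb_succ_eq κ ι W U hp2 hκ hU (hyU k), hc (k + 1), Nat.add_sub_cancel, hc k]
    module

end SprungHonda

end Literature.NumberTheory.EllipticCurves.Sprung2012.Honda

end Part12

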